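import Literature.Analysis.FluidPDE.ForwardDSSLocalEnergy
import Literature.Analysis.FluidPDE.ForwardDSSLocalEnergySobolev
import Literature.Analysis.FluidPDE.ForwardDSSLocalEnergyScaling
import Literature.Analysis.FluidPDE.CKNInterpolationEstimate
import Literature.Analysis.FluidPDE.LerayPressureDecayProofs
import Literature.Analysis.FluidPDE.LocalLerayPressureDecompositionHolds
import Literature.Analysis.FluidPDE.LocalLerayPressureRenormalisation
import Literature.Analysis.FluidPDE.LocalLerayInitialSliceLEI
import Literature.Analysis.FluidPDE.WholeSpaceIBP
import HarnessLib

/-!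
# Forward DSS solutions: the a priori bound of Bradshaw–Tsai 2019, Prop. 3.1, for every
`λ`-DSS local Leray solution — the local-energy-envelope argument

Analysis/FluidPDE proof file (theorems only, no definitions, no named facts) for the cone of the
named facts `Literature.Analysis.FluidPDE.bradshawTsai2019_prop_3_1` /
`bradshawTsai2019_dss_existence` / `chae_wolf_dss_existence` (Bradshaw–Tsai, *Discretely
self-similar solutions to the Navier–Stokes equations with data in `L²_loc` satisfying the local
energy inequality*, Analysis & PDE 12 (2019) = arXiv:1801.08060, Prop. 3.1 and Thm 1.2).

> **Bradshaw–Tsai 2019, Prop. 3.1.** Fix `λ > 1`. Assume `v₀ ∈ L³_w(ℝ³)` is `λ`-DSS and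
> divergence-free, and `v` is a `λ`-DSS local Leray solution evolving from `v₀` constructed in
> [BT1] … Let `α₀ = ‖v₀‖²_{L²(B_λ)}`. Then there exist positive `T = T(α₀, λ)` and `C(α₀, λ)` … so
> that `esssup_{0≤t≤T} ∫_{B₁}|v|² + ∫₀ᵀ∫_{B₁}|∇v|² < C` and `∫₀ᵀ∫_{B₁}|π|^{3/2} < C`.

The printed proof runs the estimate (3.7)–(3.12) on the *mollified approximants* of [BT1]'s
construction, because its closing continuity argument (3.13) ⇒ (3.14) needs a quantity continuous
in time: "In our argument, we must work with a quantity that is continuous in time. This is not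
known for `∫_{B₁}|v(t)|² dx` when `v` is a local Leray solution. Hence, we need to work at the
level of a mollified approximation scheme" (p. 8). This file proves the bound **for every `λ`-DSS
local Leray solution** (Kang–Miura–Tsai Def. 3.2 = `IsLocalLeraySolution`, viscosity `1`, any
measurable datum), with no approximants:

* `BradshawTsai2019.dss_localLeray_apriori` — for `λ > 1` and `M` there are `T, C` such that every
  `λ`-DSS local Leray solution `(v, π)` with `‖v₀‖²_{L²(B_λ)} ≤ M` admits a gauged pressure `π'`
  (`(v, π')` again a local Leray solution) with the three bounds on `(0, T) × B₁`;
* hence Prop. 3.1 (as rendered, `bradshawTsai2019_prop_3_1`) follows from [BT1]'s Thm 1.2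
  (`bradshawTsai2017_dss_localLeray_existence`) alone, exactly as in the accepted
  `bradshawTsai2019_prop_3_1_of_BT1` (not repeated here: feed `dss_localLeray_apriori` with the
  [BT1] solution, the datum being measurable as a weak-`L³` field).

**Relation to the accepted files.** The tree already proves the same reduction by a parallel
route: `BradshawTsai2019.exists_apriori_ae` (`ForwardDSSAprioriUniversal.lean`, the a.e. form of
(3.12) for every DSS local Leray solution with `E²` datum), `continuity_argument_ae`
(`ForwardDSSRunningSup.lean`), `bradshawTsai2019_prop_3_1_of_localLeray_existence`
(`ForwardDSSAprioriUniversalHolds.lean`) and the corollaries of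
`ForwardDSSExistenceUniversalReduction.lean` (`chae_wolf_dss_existence_of_thm_2_4_mollified`, …),
which put the trust base of Thm 1.2 at `{bradshawTsai2017_thm_2_4_mollified}`. The present file is
an independent second proof with a different closing argument and slightly weaker hypotheses (no
`E²` / divergence-free hypothesis on the datum: the local pressure expansion is used in the
datum-free form `pressure_decomposition_of_isLocalLeraySolution`, transcribed from the accepted
discharge `kangMiuraTsai_pressure_decomposition_holds`, whose proof does not use them). Nothing
accepted is restated; the corollaries already in the tree are not repeated.

## The argument

Let `(v, π)` be a `λ`-DSS local Leray solution, `α(t) = ∫_{B₁}|v(t)|²`.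

1. *Running majorant* (`exists_runningMajorant`): `A(t) = inf_{q>t} esssup_{(0,q)} α` is monotone,
   `α ≤ A` a.e., and `A t ≤ b` whenever `α ≤ b` a.e. on some `(0,q)`, `q > t`. A.e. statements on
   `(0,∞)` are dilation invariant (`ae_pos_comp_mul_left`), so `α(λ^{-2k}τ) ≤ A(τ)` for a.e. `τ`.
2. *Gauge* (`exists_originGaugedPressure`): `π' = π − c(t)` with `π' = π_loc + π_far` a.e. on
   `(0,T) × B_λ` (expansion at the origin, radius `λ`; `IsLocalLeraySolution.sub_pressure`).
3. *The pieces of (3.7)* for the local energy inequality from `t = 0` with the weight `φ = χ²`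
   (accepted `IsLocalLeraySolutionOn.ae_localEnergyIneq_initial_slice`): the second term by (3.6)
   slice-wise (`∫_{B_λ}|v(τ)|² = λ α(τ/λ²) ≤ λ A(τ)`); the cubic term by (3.6) and Gagliardo–Nirenberg
   on `B₁` for the weak gradient of a.e. slice (`exists_cubic_unitBall_le_of_hasWeakFDerivOn`,
   `exists_cubic_unitCylinder_le_of_majorant`; accepted `exists_eLpNorm_six_le_unitBall`) with Young;
   the pressure term by Young, Calderón–Zygmund for `π_loc` (accepted
   `exists_lintegral_localPressureNear_le`, `stein1970_normalisedPressure_ae_Lp_bound_holds`) and,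
   for `π_far`, the two-centre kernel bound with the `λ`-adic shell sum
   `∫_{|y|≥2λ}|v(τ)|²|y|⁻⁴ ≤ Σₙ λ^{-4(n+1)} λ^{n+2} A(τ)` (`exists_farField_le_majorant`,
   `lintegral_gauged_pressure_le_of_farField`).
4. *Absorption* (`exists_energy_envelope`): with `γ` small and the dissipation on `(0,1) × B_λ`
   finite (local Leray class), for a.e. `s ∈ (0,1)`:
   `α(s) + ∫₀ˢ∫_{B₁}|∇v|² ≤ α₀ + C₀∫₀ˢ(A + A³)`, and `∫₀ˢ∫_{B₁}|π'|^{3/2} ≤ C_p(∫₀ˢ(A + A³) + ∫₀ˢ∫_{B₁}|∇v|²)`.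
5. *The envelope* (`dss_localLeray_apriori`): `F(t) = α₀ + C₀∫₀ᵗ(A + A³)` is **continuous** and
   monotone, `A ≤ essSup ≤ F` on `[0,1)` (`runningMajorant_le_of_continuous`), so `F` obeys (3.13)
   with its own running supremum and the accepted `continuity_argument` applies to `F`:
   `F ≤ 2a` on `(0, T]`, `a = M + 1`, `T = (1 + 2C₀(2 + 8a²))⁻¹`; the three bounds follow (the
   dissipation up to `T` by the directed supremum over rational times).

## Design notes

* All constants are chosen before the solution (`T = T(λ, M)`, `C = C(λ, M)`), as Prop. 3.1
  requires; the absolute constants are those of the accepted Calderón–Zygmund, kernel, Sobolev and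
  scaling lemmas, the cut-off is a Mathlib bump function (`exists_unitBall_cutoff`).
* Energies are `ℝ≥0∞`-valued lower Lebesgue integrals (`BradshawTsai2019.ballEnergy`); "esssup"
  bounds are `∀ᵐ t ∈ (0,T)` bounds; the weak gradient is the one of the local Leray class.
* Small tools duplicated from heavier accepted files under primed/new names to keep the imports
  light: `add_le_of_add_two_mul_le'`, `mul_le_rpow_threeHalves_add_rpow_three`,
  `setLIntegral_timeSlab_le_of_eq_zero_off`, `exists_unitBall_cutoff` (cf. `ForwardDSSAprioriAssembly`,
  `ForwardDSSEnergyFromZero`).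

## References

* Z. Bradshaw, T.-P. Tsai, *Discretely self-similar solutions to the Navier–Stokes equations with
  data in `L²_loc` satisfying the local energy inequality*, Analysis & PDE 12 (2019) 1943–1962 =
  arXiv:1801.08060, §3: Prop. 3.1 and its proof, (3.6)–(3.14), the pressure bounds of p. 10
  [BradshawTsai2019].
* K. Kang, H. Miura, T.-P. Tsai, IMRN 2021 = arXiv:1812.10509, Def. 3.2, Lemma 3.4 (local pressure
  expansion and its gauge) [KangMiuraTsai2020].
* Z. Bradshaw, T.-P. Tsai, Ann. Henri Poincaré 18 (2017) = arXiv:1510.07504, Thm 1.2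
  (`bradshawTsai2017_dss_localLeray_existence`).
-/

noncomputable section

open MeasureTheory Set Function Filter Topology TopologicalSpace Metric
open scoped NNReal ENNReal RealInnerProductSpace ContDiff Laplacian

namespace Literature.Analysis.FluidPDE

namespace BradshawTsai2019

/-! ## A right-continuous running essential supremum -/

/-- **Running essential-supremum majorant.** For every `α : ℝ → ℝ≥0∞` there is a monotone
`A : ℝ → ℝ≥0∞` with `α ≤ A` a.e. on `(0, ∞)` and `A t ≤ b` whenever `α ≤ b` a.e. on `(0, q)` for
some `q > t` (take `A t = inf_{q > t, q ∈ ℚ} essSup_{(0,q)} α`). [folklore] -/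
theorem exists_runningMajorant (α : ℝ → ℝ≥0∞) :
    ∃ A : ℝ → ℝ≥0∞, Monotone A ∧ (∀ᵐ t : ℝ, 0 < t → α t ≤ A t) ∧
      ∀ (t q : ℝ), t < q → ∀ b : ℝ≥0∞,
        (∀ᵐ s ∂(volume.restrict (Ioo 0 q)), α s ≤ b) → A t ≤ b := by
  set A : ℝ → ℝ≥0∞ := fun t => ⨅ (q : ℚ) (_ : t < (q : ℝ)), essSup α (volume.restrict (Ioo 0 q))
    with hA
  refine ⟨A, fun t t' htt' => ?_, ?_, fun t q htq b hb => ?_⟩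
  · refine le_iInf₂ fun q hq => ?_
    show (⨅ (q : ℚ) (_ : t < (q : ℝ)), essSup α (volume.restrict (Ioo 0 q))) ≤ _
    exact iInf₂_le q (htt'.trans_lt hq)
  · have hall : ∀ᵐ t : ℝ, ∀ q : ℚ, t ∈ Ioo (0 : ℝ) q →
        α t ≤ essSup α (volume.restrict (Ioo 0 q)) := by
      refine ae_all_iff.2 fun q => ?_
      exact (ae_restrict_iff' measurableSet_Ioo).1 (ENNReal.ae_le_essSup α)
    filter_upwards [hall] with t ht h0
    exact le_iInf₂ fun q hq => ht q ⟨h0, hq⟩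
  · obtain ⟨q', htq', hq'q⟩ := exists_rat_btwn htq
    show (⨅ (q : ℚ) (_ : t < (q : ℝ)), essSup α (volume.restrict (Ioo 0 q))) ≤ _
    refine (iInf₂_le q' htq').trans ?_
    refine essSup_le_of_ae_le b ?_
    exact ae_restrict_of_ae_restrict_of_subset (Ioo_subset_Ioo_right hq'q.le) hb

/-- A.e. statements on `(0, ∞)` are stable under the dilations `τ ↦ κ τ`, `κ > 0`. [folklore] -/
theorem ae_pos_comp_mul_left {P : ℝ → Prop} (h : ∀ᵐ σ : ℝ, 0 < σ → P σ) {κ : ℝ} (hκ : 0 < κ) :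
    ∀ᵐ τ : ℝ, 0 < τ → P (κ * τ) := by
  have hmap : Measure.map (fun τ : ℝ => κ * τ) volume = ENNReal.ofReal |κ⁻¹| • volume :=
    Real.map_volume_mul_left hκ.ne'
  have h' : ∀ᵐ σ ∂(Measure.map (fun τ : ℝ => κ * τ) volume), 0 < σ → P σ := by
    rw [hmap]
    exact Measure.ae_smul_measure h _
  filter_upwards [ae_of_ae_map (measurable_const_mul κ).aemeasurable h'] with τ hτ h0
  exact hτ (mul_pos hκ h0)

/-! ## The cubic Gagliardo–Nirenberg bound on the unit ball for weakly differentiable fields -/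

/-- **Gagliardo–Nirenberg on the unit ball, cubic form, for weak derivatives.** There is a
finite constant `C` such that for every `f : ℝ³ → ℝ³` with a weak derivative `g` on `B₁` and
`α = ∫_{B₁}|f|² < ∞`, `e = ∫_{B₁}|g|²` (Frobenius density),
`∫_{B₁} |f|³ ≤ C (α^{3/2} + α^{3/4} e^{3/4})` (interpolation `‖f‖₃³ ≤ ‖f‖₂^{3/2}‖f‖₆^{3/2}` and the
Sobolev inequality `‖f‖_{L⁶(B₁)} ≤ C_S(‖f‖_{L²(B₁)} + ‖g‖_{L²(B₁)})`; Bradshaw–Tsai 2019, (3.11)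
for the limit solution instead of the approximants). [cite: BradshawTsai2019, §3 (3.11)] -/
theorem exists_cubic_unitBall_le_of_hasWeakFDerivOn :
    ∃ C : ℝ≥0∞, C ≠ ⊤ ∧
      ∀ (f : EuclideanSpace ℝ (Fin 3) → EuclideanSpace ℝ (Fin 3))
        (g : EuclideanSpace ℝ (Fin 3) → EuclideanSpace ℝ (Fin 3) →L[ℝ] EuclideanSpace ℝ (Fin 3)),
        FunctionSpaces.HasWeakFDerivOn
          (⟨ball (0 : EuclideanSpace ℝ (Fin 3)) 1, isOpen_ball⟩ : Opens (EuclideanSpace ℝ (Fin 3)))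
          volume f g →
        ∫⁻ x in ball (0 : EuclideanSpace ℝ (Fin 3)) 1, ‖f x‖ₑ ^ 2 ≠ ⊤ →
        ∫⁻ x in ball (0 : EuclideanSpace ℝ (Fin 3)) 1, ‖f x‖ₑ ^ (3 : ℝ) ≤
          C * ((∫⁻ x in ball (0 : EuclideanSpace ℝ (Fin 3)) 1, ‖f x‖ₑ ^ 2) ^ (3 / 2 : ℝ) +
            (∫⁻ x in ball (0 : EuclideanSpace ℝ (Fin 3)) 1, ‖f x‖ₑ ^ 2) ^ (3 / 4 : ℝ) *
              (∫⁻ x in ball (0 : EuclideanSpace ℝ (Fin 3)) 1,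
                ENNReal.ofReal (frobeniusNormSq (g x))) ^ (3 / 4 : ℝ)) := by
  obtain ⟨CS, hCS⟩ := exists_eLpNorm_six_le_unitBall
  refine ⟨(2 : ℝ≥0∞) ^ (1 / 2 : ℝ) * (CS : ℝ≥0∞) ^ (3 / 2 : ℝ),
    ENNReal.mul_ne_top (ENNReal.rpow_ne_top_of_nonneg (by norm_num) ENNReal.ofNat_ne_top)
      (ENNReal.rpow_ne_top_of_nonneg (by norm_num) ENNReal.coe_ne_top), fun f g hw hα => ?_⟩
  set μ : Measure (EuclideanSpace ℝ (Fin 3)) := volume.restrict (ball (0 : EuclideanSpace ℝ (Fin 3)) 1)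
    with hμ
  set α : ℝ≥0∞ := ∫⁻ x, ‖f x‖ₑ ^ 2 ∂μ with hαdef
  set e : ℝ≥0∞ := ∫⁻ x, ENNReal.ofReal (frobeniusNormSq (g x)) ∂μ with hedef
  have hfm : AEStronglyMeasurable f μ := hw.locallyIntegrableOn.aestronglyMeasurable
  -- `‖f‖_{L²(B₁)} = α^{1/2}`
  have h2r : ∫⁻ x, ‖f x‖ₑ ^ (2 : ℝ) ∂μ = α := by
    refine lintegral_congr fun x => ?_
    rw [show (2 : ℝ) = ((2 : ℕ) : ℝ) by norm_num, ENNReal.rpow_natCast]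
  have hL2 : eLpNorm f 2 μ = α ^ (1 / 2 : ℝ) := by
    rw [eLpNorm_eq_lintegral_rpow_enorm_toReal two_ne_zero ENNReal.ofNat_ne_top,
      ENNReal.toReal_ofNat, h2r]
  have hL2top : eLpNorm f 2 μ ≠ ⊤ := by
    rw [hL2]; exact ENNReal.rpow_ne_top_of_nonneg (by norm_num) hα
  -- Sobolev: `‖f‖₆ ≤ C_S (α^{1/2} + e^{1/2})`
  have h6 : eLpNorm f 6 μ ≤ CS * (α ^ (1 / 2 : ℝ) + e ^ (1 / 2 : ℝ)) := by
    have h := hCS f g hw hL2top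
    rw [hL2] at h
    exact h
  -- `(∫ |f|⁶)^{1/4} = ‖f‖₆^{3/2}`
  have h6' : (∫⁻ x, ‖f x‖ₑ ^ (6 : ℝ) ∂μ) ^ (1 / 4 : ℝ) = eLpNorm f 6 μ ^ (3 / 2 : ℝ) := by
    rw [eLpNorm_eq_lintegral_rpow_enorm_toReal (by norm_num) (by norm_num), ENNReal.toReal_ofNat,
      ← ENNReal.rpow_mul]
    norm_num
  -- interpolation
  have hint := lintegral_enorm_rpow_three_le_interpolation μ hfm
  rw [h2r, h6'] at hint
  -- `‖f‖₆^{3/2} ≤ C_S^{3/2} √2 (α^{3/4} + e^{3/4})`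
  have hpow : eLpNorm f 6 μ ^ (3 / 2 : ℝ) ≤
      (CS : ℝ≥0∞) ^ (3 / 2 : ℝ) * ((2 : ℝ≥0∞) ^ (1 / 2 : ℝ) * (α ^ (3 / 4 : ℝ) + e ^ (3 / 4 : ℝ))) := by
    calc eLpNorm f 6 μ ^ (3 / 2 : ℝ)
        ≤ ((CS : ℝ≥0∞) * (α ^ (1 / 2 : ℝ) + e ^ (1 / 2 : ℝ))) ^ (3 / 2 : ℝ) :=
          ENNReal.rpow_le_rpow h6 (by norm_num)
      _ = (CS : ℝ≥0∞) ^ (3 / 2 : ℝ) * (α ^ (1 / 2 : ℝ) + e ^ (1 / 2 : ℝ)) ^ (3 / 2 : ℝ) :=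
          ENNReal.mul_rpow_of_nonneg _ _ (by norm_num)
      _ ≤ (CS : ℝ≥0∞) ^ (3 / 2 : ℝ) * ((2 : ℝ≥0∞) ^ (1 / 2 : ℝ) *
            ((α ^ (1 / 2 : ℝ)) ^ (3 / 2 : ℝ) + (e ^ (1 / 2 : ℝ)) ^ (3 / 2 : ℝ))) := by
          gcongr
          exact add_rpow_threeHalves_le _ _
      _ = (CS : ℝ≥0∞) ^ (3 / 2 : ℝ) * ((2 : ℝ≥0∞) ^ (1 / 2 : ℝ) * (α ^ (3 / 4 : ℝ) + e ^ (3 / 4 : ℝ))) := by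
          rw [← ENNReal.rpow_mul, ← ENNReal.rpow_mul]
          norm_num
  calc ∫⁻ x, ‖f x‖ₑ ^ (3 : ℝ) ∂μ
      ≤ α ^ (3 / 4 : ℝ) * eLpNorm f 6 μ ^ (3 / 2 : ℝ) := hint
    _ ≤ α ^ (3 / 4 : ℝ) * ((CS : ℝ≥0∞) ^ (3 / 2 : ℝ) *
          ((2 : ℝ≥0∞) ^ (1 / 2 : ℝ) * (α ^ (3 / 4 : ℝ) + e ^ (3 / 4 : ℝ)))) := by gcongr
    _ = (2 : ℝ≥0∞) ^ (1 / 2 : ℝ) * (CS : ℝ≥0∞) ^ (3 / 2 : ℝ) *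
          (α ^ (3 / 4 : ℝ) * α ^ (3 / 4 : ℝ) + α ^ (3 / 4 : ℝ) * e ^ (3 / 4 : ℝ)) := by ring
    _ = (2 : ℝ≥0∞) ^ (1 / 2 : ℝ) * (CS : ℝ≥0∞) ^ (3 / 2 : ℝ) *
          (α ^ (3 / 2 : ℝ) + α ^ (3 / 4 : ℝ) * e ^ (3 / 4 : ℝ)) := by
        rw [← ENNReal.rpow_add_of_nonneg _ _ (by norm_num) (by norm_num)]
        norm_num

/-! ## The cubic term on the unit cylinder, integrated in time -/

/-- **The cubic bound on the unit cylinder for a field with a weak spatial gradient**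
(Bradshaw–Tsai 2019, (3.11) with Young's inequality, for the limit solution): let `v` have the
weak spatial gradient `G` on the slab `(0,T₀) × ℝ³` and be measurable there, and let `A` be a
monotone majorant of the unit-ball energy, `∫_{B₁}|v(t)|² ≤ A(t)` for a.e. `t > 0`. Then for
`0 < s ≤ T₀` and every `γ ∈ (0, ∞)`,
`∫₀ˢ∫_{B₁} |v|³ ≤ C ∫₀ˢ (A + (1 + γ⁻³) A³) + C γ ∫₀ˢ∫_{B₁} |G|²`, `C` an absolute constant
(Gagliardo–Nirenberg on `B₁` slice by slice, `α^{3/2} ≤ α + α³`, `α^{3/4}e^{3/4} ≤ γe + γ⁻³α³`).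
[cite: BradshawTsai2019, §3 (3.11) and p. 9 (Young with γ)] -/
theorem exists_cubic_unitCylinder_le_of_majorant :
    ∃ C : ℝ≥0∞, C ≠ 0 ∧ C ≠ ⊤ ∧
      ∀ (T₀ : ℝ) (v : ℝ → EuclideanSpace ℝ (Fin 3) → EuclideanSpace ℝ (Fin 3))
        (G : ℝ → EuclideanSpace ℝ (Fin 3) → EuclideanSpace ℝ (Fin 3) →L[ℝ] EuclideanSpace ℝ (Fin 3))
        (A : ℝ → ℝ≥0∞),
        AEStronglyMeasurable (uncurry v)
          (volume.restrict (Ioo (0 : ℝ) T₀ ×ˢ (univ : Set (EuclideanSpace ℝ (Fin 3))))) →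
        HasWeakSpatialGradientOn (slab (EuclideanSpace ℝ (Fin 3)) (Ioo 0 T₀) isOpen_Ioo) v G →
        Monotone A → (∀ᵐ t : ℝ, 0 < t → ballEnergy v t ≤ A t) →
        ∀ (s : ℝ), s ≤ T₀ → ∀ (γ : ℝ≥0∞), γ ≠ 0 → γ ≠ ⊤ →
          ∫⁻ z in Ioo 0 s ×ˢ ball (0 : EuclideanSpace ℝ (Fin 3)) 1, ‖v z.1 z.2‖ₑ ^ (3 : ℝ) ≤
            C * (∫⁻ σ in Ioo 0 s, (A σ + (1 + (γ⁻¹) ^ 3) * A σ ^ 3)) +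
              C * γ * ∫⁻ z in Ioo 0 s ×ˢ ball (0 : EuclideanSpace ℝ (Fin 3)) 1,
                ENNReal.ofReal (frobeniusNormSq (G z.1 z.2)) := by
  obtain ⟨C₀, hC₀top, hC₀⟩ := exists_cubic_unitBall_le_of_hasWeakFDerivOn
  refine ⟨C₀ + 1, by simp, ENNReal.add_ne_top.2 ⟨hC₀top, ENNReal.one_ne_top⟩,
    fun T₀ v G A hvm hG hA hαA s hsT γ hγ0 hγt => ?_⟩
  set C : ℝ≥0∞ := C₀ + 1 with hCdef
  have hC0C : C₀ ≤ C := le_self_add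
  set B : Set (EuclideanSpace ℝ (Fin 3)) := ball 0 1 with hB
  set μt : Measure ℝ := volume.restrict (Ioo 0 s) with hμt
  set μB : Measure (EuclideanSpace ℝ (Fin 3)) := volume.restrict B with hμB
  -- slice functionals
  set κ : ℝ → ℝ≥0∞ := fun σ => ∫⁻ x in B, ‖v σ x‖ₑ ^ (3 : ℝ) with hκ
  set e : ℝ → ℝ≥0∞ := fun σ => ∫⁻ x in B, ENNReal.ofReal (frobeniusNormSq (G σ x)) with he
  -- the box `(0,s) × B` inside the slab `(0,T₀) × ℝ³`
  have hbox : μt.prod μB = volume.restrict (Ioo 0 s ×ˢ B) := by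
    rw [hμt, hμB, Measure.prod_restrict, ← Measure.volume_eq_prod]
  have hsub : Ioo 0 s ×ˢ B ⊆ Ioo (0 : ℝ) T₀ ×ˢ (univ : Set (EuclideanSpace ℝ (Fin 3))) :=
    Set.prod_mono (Ioo_subset_Ioo_right hsT) (subset_univ _)
  have hvmS : AEStronglyMeasurable (uncurry v) (μt.prod μB) := by
    rw [hbox]
    exact hvm.mono_measure (Measure.restrict_mono hsub le_rfl)
  have hGm : AEStronglyMeasurable (uncurry G)
      (volume.restrict (Ioo (0 : ℝ) T₀ ×ˢ (univ : Set (EuclideanSpace ℝ (Fin 3))))) :=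
    hG.locallyIntegrableOn_grad.aestronglyMeasurable
  have hGmS : AEStronglyMeasurable (uncurry G) (μt.prod μB) := by
    rw [hbox]
    exact hGm.mono_measure (Measure.restrict_mono hsub le_rfl)
  have hF3 : AEMeasurable (fun z : ℝ × EuclideanSpace ℝ (Fin 3) => ‖v z.1 z.2‖ₑ ^ (3 : ℝ))
      (μt.prod μB) := hvmS.enorm.pow_const _
  have hFG : AEMeasurable (fun z : ℝ × EuclideanSpace ℝ (Fin 3) =>
      ENNReal.ofReal (frobeniusNormSq (G z.1 z.2))) (μt.prod μB) :=
    (continuous_frobeniusNormSq'.comp_aestronglyMeasurable hGmS).aemeasurable.ennreal_ofReal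
  have hκm : AEMeasurable κ μt := hF3.lintegral_prod_right'
  have hem : AEMeasurable e μt := hFG.lintegral_prod_right'
  -- Tonelli
  have hT3 : ∫⁻ z in Ioo 0 s ×ˢ B, ‖v z.1 z.2‖ₑ ^ (3 : ℝ) = ∫⁻ σ, κ σ ∂μt := by
    rw [← hbox, lintegral_prod _ hF3]
  have hTG : ∫⁻ z in Ioo 0 s ×ˢ B, ENNReal.ofReal (frobeniusNormSq (G z.1 z.2)) =
      ∫⁻ σ, e σ ∂μt := by
    rw [← hbox, lintegral_prod _ hFG]
  -- a.e. in `σ ∈ (0,s)`: the slice has the weak derivative `G σ` on `B₁`, and `α ≤ A`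
  have hle : (⟨Ioo (0 : ℝ) T₀ ×ˢ ((⟨B, isOpen_ball⟩ : Opens (EuclideanSpace ℝ (Fin 3))) :
      Set (EuclideanSpace ℝ (Fin 3))), isOpen_Ioo.prod isOpen_ball⟩ : Opens (ℝ × EuclideanSpace ℝ (Fin 3))) ≤
      slab (EuclideanSpace ℝ (Fin 3)) (Ioo 0 T₀) isOpen_Ioo := fun z hz => mem_slab.2 hz.1
  have hslice : ∀ᵐ σ ∂μt, FunctionSpaces.HasWeakFDerivOn
      (⟨B, isOpen_ball⟩ : Opens (EuclideanSpace ℝ (Fin 3))) volume (v σ) (G σ) :=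
    ae_restrict_of_ae_restrict_of_subset (Ioo_subset_Ioo_right hsT)
      ((hG.mono hle).ae_hasWeakFDerivOn_slice)
  have hαA' : ∀ᵐ σ ∂μt, ballEnergy v σ ≤ A σ := by
    rw [hμt, ae_restrict_iff' measurableSet_Ioo]
    filter_upwards [hαA] with σ hσ hσI
    exact hσ hσI.1
  -- the slice estimate
  have hinner : ∀ᵐ σ ∂μt, κ σ ≤ C * (A σ + (1 + (γ⁻¹) ^ 3) * A σ ^ 3) + C * γ * e σ := by
    filter_upwards [hslice, hαA'] with σ hwσ hασ
    by_cases hAσ : A σ = ⊤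
    · have h1 : C * (A σ + (1 + (γ⁻¹) ^ 3) * A σ ^ 3) = ⊤ := by
        rw [hAσ, top_add, ENNReal.mul_top (by simp [hCdef])]
      rw [h1, top_add]
      exact le_top
    have hαtop : ballEnergy v σ ≠ ⊤ := ne_top_of_le_ne_top hAσ hασ
    have hGN := hC₀ (v σ) (G σ) hwσ hαtop
    -- `α^{3/2} + α^{3/4} e^{3/4} ≤ A^{3/2} + A^{3/4} e^{3/4} ≤ A + A³ + γ e + γ⁻³ A³`
    have hY : A σ ^ (3 / 4 : ℝ) * e σ ^ (3 / 4 : ℝ) ≤ γ * e σ + (γ⁻¹) ^ 3 * A σ ^ 3 := by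
      have h := mul_rpow_three_quarters_le 1 (A σ) (e σ) hγ0 hγt
      rwa [one_mul, one_pow, one_mul] at h
    calc κ σ ≤ C₀ * (ballEnergy v σ ^ (3 / 2 : ℝ) +
          ballEnergy v σ ^ (3 / 4 : ℝ) * e σ ^ (3 / 4 : ℝ)) := hGN
      _ ≤ C * (A σ ^ (3 / 2 : ℝ) + A σ ^ (3 / 4 : ℝ) * e σ ^ (3 / 4 : ℝ)) := by
          gcongr
      _ ≤ C * ((A σ + A σ ^ 3) + (γ * e σ + (γ⁻¹) ^ 3 * A σ ^ 3)) := by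
          gcongr
          · exact rpow_three_halves_le_self_add_pow_three _
      _ = C * (A σ + (1 + (γ⁻¹) ^ 3) * A σ ^ 3) + C * γ * e σ := by ring
  -- integrate in time
  have hAm : Measurable A := hA.measurable
  have hIm : Measurable fun σ => A σ + (1 + (γ⁻¹) ^ 3) * A σ ^ 3 :=
    hAm.add ((hAm.pow_const 3).const_mul _)
  calc ∫⁻ z in Ioo 0 s ×ˢ B, ‖v z.1 z.2‖ₑ ^ (3 : ℝ) = ∫⁻ σ, κ σ ∂μt := hT3
    _ ≤ ∫⁻ σ, (C * (A σ + (1 + (γ⁻¹) ^ 3) * A σ ^ 3) + C * γ * e σ) ∂μt := lintegral_mono_ae hinner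
    _ = C * (∫⁻ σ, (A σ + (1 + (γ⁻¹) ^ 3) * A σ ^ 3) ∂μt) + C * γ * ∫⁻ σ, e σ ∂μt := by
        rw [lintegral_add_left ((hIm.const_mul C)), lintegral_const_mul _ hIm,
          lintegral_const_mul'' _ hem]
    _ = _ := by rw [hTG]

/-! ## The far field of a DSS field: the shell sum -/

/-- **`λ`-adic shells cover the exterior of a ball of radius `≥ λ`.** For `c > 1` and `ρ ≥ c`,
every `y` with `‖y‖ ≥ ρ` lies in a shell `c^{n+1} ≤ ‖y‖ < c^{n+2}`, `n ∈ ℕ`. [folklore] -/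
theorem compl_ball_subset_iUnion_dssShell {c : ℝ} (hc : 1 < c) {ρ : ℝ} (hρ : c ≤ ρ) :
    (ball (0 : EuclideanSpace ℝ (Fin 3)) ρ)ᶜ ⊆
      ⋃ n : ℕ, {y : EuclideanSpace ℝ (Fin 3) | c ^ (n + 1) ≤ ‖y‖ ∧ ‖y‖ < c ^ (n + 2)} := by
  intro y hy
  rw [mem_compl_iff, mem_ball_zero_iff, not_lt] at hy
  have hc0 : 0 < c := zero_lt_one.trans hc
  have hyn : 0 < ‖y‖ := hc0.trans_le (hρ.trans hy)
  obtain ⟨m, hm1, hm2⟩ := exists_mem_Ico_zpow hyn hc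
  have hm : 1 ≤ m := by
    by_contra h
    have h' : m + 1 ≤ 1 := by omega
    have h1 : c ^ (m + 1) ≤ c ^ (1 : ℤ) := zpow_le_zpow_right₀ hc.le h'
    rw [zpow_one] at h1
    linarith
  refine mem_iUnion.2 ⟨(m - 1).toNat, ?_, ?_⟩
  · have e : ((((m - 1).toNat + 1 : ℕ)) : ℤ) = m := by omega
    rw [← zpow_natCast, e]
    exact hm1
  · have e : ((((m - 1).toNat + 2 : ℕ)) : ℤ) = m + 1 := by omega
    rw [← zpow_natCast, e]
    exact hm2

/-- **The far field of a DSS field is controlled by the unit-ball energy** (Bradshaw–Tsai 2019,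
p. 10, the bound for `π_far`: "`∫₀ᵗ∫_{A_k} |v_ε(y,s)|² dy ds ≤ Cλ^{3k+5}∫₀^{t/λ^{2k+4}}∫_{B₁}|v_ε|²`",
here in sliced form with the kernel weight `|y|⁻⁴` of the local expansion): for a `c`-DSS field
`w` (`c > 1`) and a monotone majorant `A` of `α(t) = ∫_{B₁}|w(t)|²` (`α ≤ A` a.e. on `(0,∞)`),
for a.e. `τ > 0`, `∫_{|y| ≥ 2c} |w(τ,y)|² |y|⁻⁴ dy ≤ K A(τ)` with
`K = Σ_n c^{-4(n+1)} c^{n+2} < ∞` (the shells `c^{n+1} ≤ |y| < c^{n+2}` and the scaling law (3.6):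
`∫_{B_{c^{n+2}}} |w(τ)|² = c^{n+2} α(τ c^{-2(n+2)}) ≤ c^{n+2} A(τ)`). [cite: BradshawTsai2019, §3 p. 10 (bound for π_far via (3.6))] -/
theorem exists_farField_le_majorant {c : ℝ} (hc : 1 < c) :
    ∃ K : ℝ≥0∞, K ≠ ⊤ ∧ ∀ (w : ℝ → EuclideanSpace ℝ (Fin 3) → EuclideanSpace ℝ (Fin 3))
      (A : ℝ → ℝ≥0∞), IsDiscretelySelfSimilar c w → Monotone A →
      (∀ᵐ t : ℝ, 0 < t → ballEnergy w t ≤ A t) →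
      ∀ᵐ τ : ℝ, 0 < τ →
        ∫⁻ y in (ball (0 : EuclideanSpace ℝ (Fin 3)) (2 * c))ᶜ,
          ‖w τ y‖ₑ ^ (2 : ℕ) * RieszKernel.powKer 4 (y - 0) ≤ K * A τ := by
  have hc0 : 0 < c := zero_lt_one.trans hc
  -- the constant: `K = Σ_n c^{-4(n+1)} · c^{n+2} = Σ_n c⁻² (c⁻³)ⁿ`
  set a : ℕ → ℝ≥0∞ := fun n => ENNReal.ofReal (c⁻¹ ^ 2) * ENNReal.ofReal (c⁻¹ ^ 3) ^ n with ha
  have ha_eq : ∀ n : ℕ, ENNReal.ofReal (c ^ (n + 2)) * ENNReal.ofReal ((c ^ (n + 1)) ^ (-(4 : ℝ))) =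
      a n := by
    intro n
    have hcn0 : (0 : ℝ) < c ^ (n + 1) := by positivity
    have e1 : (c ^ (n + 1)) ^ (-(4 : ℝ)) = (c ^ (3 * n + 2))⁻¹ * (c ^ (n + 2))⁻¹ := by
      rw [Real.rpow_neg hcn0.le, show (4 : ℝ) = ((4 : ℕ) : ℝ) by norm_num, Real.rpow_natCast,
        ← pow_mul, show (n + 1) * 4 = (3 * n + 2) + (n + 2) by ring, pow_add, mul_inv]
    have e2 : c ^ (n + 2) * (c ^ (n + 1)) ^ (-(4 : ℝ)) = c⁻¹ ^ 2 * (c⁻¹ ^ 3) ^ n := by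
      rw [e1, mul_comm ((c ^ (3 * n + 2))⁻¹), ← mul_assoc,
        mul_inv_cancel₀ (pow_ne_zero _ hc0.ne'), one_mul, ← pow_mul, ← pow_add, inv_pow,
        show 2 + 3 * n = 3 * n + 2 by ring]
    rw [ha]
    dsimp only
    rw [← ENNReal.ofReal_pow (by positivity) n, ← ENNReal.ofReal_mul (by positivity),
      ← ENNReal.ofReal_mul (by positivity), e2]
  have hr : ENNReal.ofReal (c⁻¹ ^ 3) < 1 := by
    rw [← ENNReal.ofReal_one]
    exact (ENNReal.ofReal_lt_ofReal_iff zero_lt_one).2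
      (pow_lt_one₀ (inv_nonneg.2 hc0.le) (inv_lt_one_of_one_lt₀ hc) three_ne_zero)
  set K : ℝ≥0∞ := ∑' n, a n with hK
  have hKval : K = ENNReal.ofReal (c⁻¹ ^ 2) * (1 - ENNReal.ofReal (c⁻¹ ^ 3))⁻¹ := by
    rw [hK, ha, ENNReal.tsum_mul_left, ENNReal.tsum_geometric]
  have hKtop : K ≠ ⊤ := by
    rw [hKval]
    exact ENNReal.mul_ne_top ENNReal.ofReal_ne_top
      (ENNReal.inv_ne_top.2 (tsub_pos_of_lt hr).ne')
  refine ⟨K, hKtop, fun w A hw hA hαA => ?_⟩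
  -- a.e. in `τ`: all the rescaled energies are below `A τ`
  have hall : ∀ᵐ τ : ℝ, ∀ n : ℕ, 0 < τ →
      ballEnergy w (((c ^ (n + 2)) ^ 2)⁻¹ * τ) ≤ A τ := by
    refine ae_all_iff.2 fun n => ?_
    have hκ : 0 < ((c ^ (n + 2)) ^ 2)⁻¹ := by positivity
    filter_upwards [ae_pos_comp_mul_left hαA hκ] with τ hτ h0
    refine (hτ h0).trans (hA ?_)
    have h1 : ((c ^ (n + 2)) ^ 2)⁻¹ ≤ 1 :=
      inv_le_one_of_one_le₀ (one_le_pow₀ (one_le_pow₀ hc.le))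
    calc ((c ^ (n + 2)) ^ 2)⁻¹ * τ ≤ 1 * τ := mul_le_mul_of_nonneg_right h1 h0.le
      _ = τ := one_mul τ
  filter_upwards [hall] with τ hτ h0
  -- shell by shell
  set S : ℕ → Set (EuclideanSpace ℝ (Fin 3)) := fun n =>
    {y | c ^ (n + 1) ≤ ‖y‖ ∧ ‖y‖ < c ^ (n + 2)} with hS
  have hshell : ∀ n, ∫⁻ y in S n, ‖w τ y‖ₑ ^ (2 : ℕ) * RieszKernel.powKer 4 (y - 0) ≤
      a n * A τ := by
    intro n
    have hcn : 0 < c ^ (n + 1) := by positivity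
    calc ∫⁻ y in S n, ‖w τ y‖ₑ ^ (2 : ℕ) * RieszKernel.powKer 4 (y - 0)
        ≤ ∫⁻ y in S n, ‖w τ y‖ₑ ^ (2 : ℕ) * ENNReal.ofReal ((c ^ (n + 1)) ^ (-(4 : ℝ))) := by
          refine lintegral_mono_ae ((ae_restrict_iff' ?_).2 (ae_of_all _ fun y hy => ?_))
          · exact (measurableSet_le measurable_const measurable_norm).inter
              (measurableSet_lt measurable_norm measurable_const)
          · refine mul_le_mul' le_rfl ?_
            rw [sub_zero]
            exact RieszKernel.powKer_le_const (by norm_num) hcn hy.1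
      _ = (∫⁻ y in S n, ‖w τ y‖ₑ ^ (2 : ℕ)) * ENNReal.ofReal ((c ^ (n + 1)) ^ (-(4 : ℝ))) :=
          lintegral_mul_const' _ _ ENNReal.ofReal_ne_top
      _ ≤ (∫⁻ y in ball (0 : EuclideanSpace ℝ (Fin 3)) (c ^ (n + 2)), ‖w τ y‖ₑ ^ (2 : ℕ)) *
            ENNReal.ofReal ((c ^ (n + 1)) ^ (-(4 : ℝ))) := by
          gcongr
          exact fun y (hy : c ^ (n + 1) ≤ ‖y‖ ∧ ‖y‖ < c ^ (n + 2)) => mem_ball_zero_iff.2 hy.2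
      _ = ENNReal.ofReal (c ^ (n + 2)) * ballEnergy w (((c ^ (n + 2)) ^ 2)⁻¹ * τ) *
            ENNReal.ofReal ((c ^ (n + 1)) ^ (-(4 : ℝ))) := by
          rw [setLIntegral_ball_enorm_sq_eq_ballEnergy (by positivity)
            (isDiscretelySelfSimilar_pow hw (n + 2)) τ]
      _ ≤ ENNReal.ofReal (c ^ (n + 2)) * A τ * ENNReal.ofReal ((c ^ (n + 1)) ^ (-(4 : ℝ))) := by
          gcongr
          exact hτ n h0
      _ = a n * A τ := by rw [← ha_eq n]; ring
  calc ∫⁻ y in (ball (0 : EuclideanSpace ℝ (Fin 3)) (2 * c))ᶜ,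
        ‖w τ y‖ₑ ^ (2 : ℕ) * RieszKernel.powKer 4 (y - 0)
      ≤ ∫⁻ y in ⋃ n, S n, ‖w τ y‖ₑ ^ (2 : ℕ) * RieszKernel.powKer 4 (y - 0) :=
        lintegral_mono_set (compl_ball_subset_iUnion_dssShell hc (by linarith))
    _ ≤ ∑' n, ∫⁻ y in S n, ‖w τ y‖ₑ ^ (2 : ℕ) * RieszKernel.powKer 4 (y - 0) :=
        lintegral_iUnion_le _ _
    _ ≤ ∑' n, a n * A τ := ENNReal.tsum_le_tsum hshell
    _ = K * A τ := by rw [ENNReal.tsum_mul_right]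

/-! ## The gauged pressure of a DSS local Leray solution on `(0,s) × B_c` -/

/-- **The `L^{3/2}` bound for the gauged pressure on the cylinder `(0,s) × B_c`** (Bradshaw–Tsai
2019, p. 10, the bounds for `π_near` and `π_far`, here for the local expansion of
Kang–Miura–Tsai 2021, Lemma 3.4 at the centre `0` with radius `c`): if
`π − g(t) = π_loc + π_far` a.e. on `(0,s) × B_c` with `g` measurable in time, and the far field
of `v` is controlled slice-wise by `K A(τ)` (`exists_farField_le_majorant`), then
`∫₀ˢ∫_{B_c} |π − g|^{3/2} ≤ √2 Cₙ ∫₀ˢ∫_{B_{2c}} |v|³ + √2 |B_c| (C_K c K)^{3/2} ∫₀ˢ A^{3/2}`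
(near field: Calderón–Zygmund slice by slice; far field: the pointwise two-centre kernel bound).
[cite: BradshawTsai2019, §3 p. 10 (bounds for π_near, π_far)] -/
theorem lintegral_gauged_pressure_le_of_farField
    {Cn : ℝ≥0∞} (hCn0 : Cn ≠ 0)
    (hnear : ∀ (x₀ : EuclideanSpace ℝ (Fin 3)) (r : ℝ)
        (v : ℝ → EuclideanSpace ℝ (Fin 3) → EuclideanSpace ℝ (Fin 3)) (t : ℝ),
        AEStronglyMeasurable (v t) volume →
        ∫⁻ x in ball x₀ (2 * r), ‖v t x‖ₑ ^ (3 : ℕ) ≠ ⊤ →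
          ∫⁻ x, ‖localPressureNear x₀ r v t x‖ₑ ^ (3 / 2 : ℝ) ≤
            Cn * ∫⁻ x in ball x₀ (2 * r), ‖v t x‖ₑ ^ (3 : ℕ))
    {CK : ℝ} (hCK0 : 0 ≤ CK)
    (hCK : ∀ x₀ x y a : EuclideanSpace ℝ (Fin 3), 2 * ‖x - x₀‖ ≤ ‖y - x₀‖ → y ≠ x₀ →
      |pressureKernel (x - y) a - pressureKernel (x₀ - y) a| ≤
        CK * ‖x - x₀‖ * ‖a‖ ^ 2 / ‖y - x₀‖ ^ 4)
    {ν : ℝ} {u₀ : EuclideanSpace ℝ (Fin 3) → EuclideanSpace ℝ (Fin 3)}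
    {v : ℝ → EuclideanSpace ℝ (Fin 3) → EuclideanSpace ℝ (Fin 3)}
    {π : ℝ → EuclideanSpace ℝ (Fin 3) → ℝ} (hv : IsLocalLeraySolution ν u₀ v π)
    {c : ℝ} (hc : 0 < c) {s : ℝ}
    {g : ℝ → ℝ} (hgm : AEStronglyMeasurable g (volume.restrict (Ioo 0 s)))
    (hdec : ∀ᵐ z ∂(volume.restrict (Ioo 0 s ×ˢ ball (0 : EuclideanSpace ℝ (Fin 3)) c)),
      π z.1 z.2 - g z.1 =
        localPressureNear 0 c v z.1 z.2 + localPressureFar 0 c v z.1 z.2)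
    {A : ℝ → ℝ≥0∞} (hA : Measurable A) {K : ℝ≥0∞}
    (hfar : ∀ᵐ τ : ℝ, 0 < τ →
      ∫⁻ y in (ball (0 : EuclideanSpace ℝ (Fin 3)) (2 * c))ᶜ,
        ‖v τ y‖ₑ ^ (2 : ℕ) * RieszKernel.powKer 4 (y - 0) ≤ K * A τ) :
    ∫⁻ z in Ioo 0 s ×ˢ ball (0 : EuclideanSpace ℝ (Fin 3)) c, ‖π z.1 z.2 - g z.1‖ₑ ^ (3 / 2 : ℝ) ≤
      (2 : ℝ≥0∞) ^ (1 / 2 : ℝ) * Cn *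
          (∫⁻ z in Ioo 0 s ×ˢ ball (0 : EuclideanSpace ℝ (Fin 3)) (2 * c), ‖v z.1 z.2‖ₑ ^ (3 : ℝ)) +
        (2 : ℝ≥0∞) ^ (1 / 2 : ℝ) * volume (ball (0 : EuclideanSpace ℝ (Fin 3)) c) *
          (ENNReal.ofReal (CK * c) * K) ^ (3 / 2 : ℝ) * ∫⁻ τ in Ioo 0 s, A τ ^ (3 / 2 : ℝ) := by
  -- ## names
  set G₃ : ℝ≥0∞ := ∫⁻ z in Ioo 0 s ×ˢ ball (0 : EuclideanSpace ℝ (Fin 3)) (2 * c),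
    ‖v z.1 z.2‖ₑ ^ (3 : ℝ) with hG₃def
  set B : Set (EuclideanSpace ℝ (Fin 3)) := ball 0 c with hB
  set N := localPressureNear (0 : EuclideanSpace ℝ (Fin 3)) c v with hN
  set Fa := localPressureFar (0 : EuclideanSpace ℝ (Fin 3)) c v with hFa
  set μt : Measure ℝ := volume.restrict (Ioo 0 s) with hμt
  set μB : Measure (EuclideanSpace ℝ (Fin 3)) := volume.restrict B with hμB
  set s2 : ℝ≥0∞ := (2 : ℝ≥0∞) ^ (1 / 2 : ℝ) with hs2
  set VB : ℝ≥0∞ := volume (ball (0 : EuclideanSpace ℝ (Fin 3)) c) with hVB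
  set cK : ℝ≥0∞ := ENNReal.ofReal (CK * c) with hcK
  -- slice functionals
  set g₃ : ℝ → ℝ≥0∞ := fun t => ∫⁻ x in ball (0 : EuclideanSpace ℝ (Fin 3)) (2 * c),
    ‖v t x‖ₑ ^ (3 : ℝ) with hg₃
  set far : ℝ → ℝ≥0∞ := fun t =>
    ∫⁻ y in (ball (0 : EuclideanSpace ℝ (Fin 3)) (2 * c))ᶜ,
      ‖v t y‖ₑ ^ (2 : ℕ) * RieszKernel.powKer 4 (y - 0) with hfardef
  show ∫⁻ z in Ioo 0 s ×ˢ B, ‖π z.1 z.2 - g z.1‖ₑ ^ (3 / 2 : ℝ) ≤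
    s2 * Cn * G₃ + s2 * VB * (cK * K) ^ (3 / 2 : ℝ) * ∫⁻ τ in Ioo 0 s, A τ ^ (3 / 2 : ℝ)
  -- ## finiteness of the constants
  have hs2top : s2 ≠ ⊤ := ENNReal.rpow_ne_top_of_nonneg (by norm_num) ENNReal.ofNat_ne_top
  have hα0 : s2 * Cn ≠ 0 :=
    mul_ne_zero (ENNReal.rpow_pos (by norm_num) ENNReal.ofNat_ne_top).ne' hCn0
  -- ## measurability on the slab and on the boxes
  have hvm : AEStronglyMeasurable (uncurry v)
      (volume.restrict (Ioi (0 : ℝ) ×ˢ (univ : Set (EuclideanSpace ℝ (Fin 3))))) :=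
    hv.aestronglyMeasurable
  have hπm := hv.aestronglyMeasurable_pressure
  have hbox : ∀ S : Set (EuclideanSpace ℝ (Fin 3)),
      μt.prod (volume.restrict S) = volume.restrict (Ioo 0 s ×ˢ S) := fun S => by
    rw [hμt, Measure.prod_restrict, ← Measure.volume_eq_prod]
  have hsub : ∀ S : Set (EuclideanSpace ℝ (Fin 3)),
      Ioo 0 s ×ˢ S ⊆ Ioi (0 : ℝ) ×ˢ (univ : Set (EuclideanSpace ℝ (Fin 3))) := fun S =>
    Set.prod_mono Ioo_subset_Ioi_self (subset_univ _)
  have hvmS : ∀ S : Set (EuclideanSpace ℝ (Fin 3)),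
      AEStronglyMeasurable (uncurry v) (μt.prod (volume.restrict S)) := fun S => by
    rw [hbox]
    exact hvm.mono_measure (Measure.restrict_mono (hsub S) le_rfl)
  have hF3 : AEMeasurable (fun z : ℝ × EuclideanSpace ℝ (Fin 3) => ‖v z.1 z.2‖ₑ ^ (3 : ℝ))
      (μt.prod (volume.restrict (ball (0 : EuclideanSpace ℝ (Fin 3)) (2 * c)))) :=
    (hvmS _).enorm.pow_const _
  have hg₃m : AEMeasurable g₃ μt := hF3.lintegral_prod_right'
  -- Tonelli for the cubic functional
  have hT3 : G₃ = ∫⁻ t, g₃ t ∂μt := by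
    rw [hG₃def, ← hbox, lintegral_prod _ hF3]
  have hGm : AEStronglyMeasurable (fun z : ℝ × EuclideanSpace ℝ (Fin 3) => π z.1 z.2 - g z.1)
      (μt.prod μB) := by
    refine AEStronglyMeasurable.sub ?_ ?_
    · rw [hμB, hbox]
      exact hπm.mono_measure (Measure.restrict_mono (hsub B) le_rfl)
    · exact hgm.comp_fst
  have hTI : ∫⁻ z in Ioo 0 s ×ˢ B, ‖π z.1 z.2 - g z.1‖ₑ ^ (3 / 2 : ℝ) =
      ∫⁻ t, ∫⁻ x, ‖π t x - g t‖ₑ ^ (3 / 2 : ℝ) ∂μB ∂μt := by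
    rw [← hbox B, ← hμB, lintegral_prod _ (hGm.enorm.pow_const _)]
  -- ## the case `G₃ = ∞`
  by_cases hG₃ : G₃ = ⊤
  · rw [hG₃, ENNReal.mul_top hα0, top_add]
    exact le_top
  -- ## a.e. in `t`: slice facts
  have hslice_meas := hv.ae_aestronglyMeasurable_slice s
  have hfin : ∀ᵐ t ∂μt, g₃ t < ⊤ := by
    refine ae_lt_top' hg₃m ?_
    rw [← hT3]
    exact hG₃
  have hdec' : ∀ᵐ t ∂μt, ∀ᵐ x ∂μB, π t x - g t = N t x + Fa t x := by
    have h1 : ∀ᵐ z ∂μt.prod μB, π z.1 z.2 - g z.1 = N z.1 z.2 + Fa z.1 z.2 := by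
      rw [hμB, hbox]
      exact hdec
    exact Measure.ae_ae_of_ae_prod h1
  have hfar' : ∀ᵐ t ∂μt, far t ≤ K * A t := by
    rw [hμt, ae_restrict_iff' measurableSet_Ioo]
    filter_upwards [hfar] with t ht htI
    exact ht htI.1
  -- ## the slice estimate
  have hinner : ∀ᵐ t ∂μt, ∫⁻ x, ‖π t x - g t‖ₑ ^ (3 / 2 : ℝ) ∂μB ≤
      s2 * Cn * g₃ t + s2 * VB * (cK * K) ^ (3 / 2 : ℝ) * A t ^ (3 / 2 : ℝ) := by
    filter_upwards [hslice_meas, hfin, hdec', hfar'] with t hmt hft hdt hfart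
    -- the far field bounds `π_far` on `B`
    have hFaB : ∀ x ∈ B, ‖Fa t x‖ₑ ≤ cK * far t := fun x hx =>
      enorm_localPressureFar_le hCK0 hCK 0 hc v t hx
    have hM : (cK * far t) ^ (3 / 2 : ℝ) ≤ (cK * K) ^ (3 / 2 : ℝ) * A t ^ (3 / 2 : ℝ) := by
      rw [← ENNReal.mul_rpow_of_nonneg _ _ (by norm_num)]
      refine ENNReal.rpow_le_rpow ?_ (by norm_num)
      rw [mul_assoc]
      exact mul_le_mul' le_rfl hfart
    -- the near field at time `t` (the cubic integrand with a natural exponent)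
    have hg₃t : ∫⁻ x in ball (0 : EuclideanSpace ℝ (Fin 3)) (2 * c), ‖v t x‖ₑ ^ (3 : ℕ) = g₃ t := by
      refine lintegral_congr fun x => ?_
      rw [← ENNReal.rpow_natCast]
      norm_num
    have hNt : ∫⁻ x, ‖N t x‖ₑ ^ (3 / 2 : ℝ) ∂μB ≤ Cn * g₃ t := by
      have hft' : ∫⁻ x in ball (0 : EuclideanSpace ℝ (Fin 3)) (2 * c), ‖v t x‖ₑ ^ (3 : ℕ) ≠ ⊤ := by
        rw [hg₃t]; exact hft.ne
      have h := hnear 0 c v t hmt hft'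
      rw [hg₃t] at h
      exact (lintegral_mono' Measure.restrict_le_self le_rfl).trans h
    -- assemble on the slice
    calc ∫⁻ x, ‖π t x - g t‖ₑ ^ (3 / 2 : ℝ) ∂μB
        = ∫⁻ x, ‖N t x + Fa t x‖ₑ ^ (3 / 2 : ℝ) ∂μB := by
          refine lintegral_congr_ae ?_
          filter_upwards [hdt] with x hx
          rw [hx]
      _ ≤ ∫⁻ x, (‖N t x‖ₑ + cK * far t) ^ (3 / 2 : ℝ) ∂μB := by
          rw [hμB]
          refine setLIntegral_mono' measurableSet_ball fun x hx => ?_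
          exact ENNReal.rpow_le_rpow ((enorm_add_le _ _).trans
            (add_le_add le_rfl (hFaB x hx))) (by norm_num)
      _ ≤ ∫⁻ x, s2 * (‖N t x‖ₑ ^ (3 / 2 : ℝ) + (cK * far t) ^ (3 / 2 : ℝ)) ∂μB :=
          lintegral_mono fun x => add_rpow_threeHalves_le _ _
      _ = s2 * (∫⁻ x, ‖N t x‖ₑ ^ (3 / 2 : ℝ) ∂μB + (cK * far t) ^ (3 / 2 : ℝ) * volume B) := by
          rw [lintegral_const_mul' _ _ hs2top, lintegral_add_right' _ aemeasurable_const,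
            lintegral_const, hμB, Measure.restrict_apply_univ]
      _ ≤ s2 * (Cn * g₃ t + (cK * K) ^ (3 / 2 : ℝ) * A t ^ (3 / 2 : ℝ) * VB) := by
          gcongr
      _ = s2 * Cn * g₃ t + s2 * VB * (cK * K) ^ (3 / 2 : ℝ) * A t ^ (3 / 2 : ℝ) := by ring
  -- ## integrate in time
  have hAm' : AEMeasurable (fun t => A t ^ (3 / 2 : ℝ)) μt := (hA.pow_const _).aemeasurable
  calc ∫⁻ z in Ioo 0 s ×ˢ B, ‖π z.1 z.2 - g z.1‖ₑ ^ (3 / 2 : ℝ)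
      = ∫⁻ t, ∫⁻ x, ‖π t x - g t‖ₑ ^ (3 / 2 : ℝ) ∂μB ∂μt := hTI
    _ ≤ ∫⁻ t, (s2 * Cn * g₃ t + s2 * VB * (cK * K) ^ (3 / 2 : ℝ) * A t ^ (3 / 2 : ℝ)) ∂μt :=
        lintegral_mono_ae hinner
    _ = s2 * Cn * ∫⁻ t, g₃ t ∂μt +
          s2 * VB * (cK * K) ^ (3 / 2 : ℝ) * ∫⁻ t, A t ^ (3 / 2 : ℝ) ∂μt := by
        rw [lintegral_add_right' _ (hAm'.const_mul _), lintegral_const_mul'' _ hg₃m,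
          lintegral_const_mul'' _ hAm']
    _ = s2 * Cn * G₃ + s2 * VB * (cK * K) ^ (3 / 2 : ℝ) * ∫⁻ τ in Ioo 0 s, A τ ^ (3 / 2 : ℝ) := by
        rw [hT3]

/-! ## The local pressure expansion at the origin, gauged by a measurable function of time -/

/-- **The local pressure expansion of a local Leray solution, without hypotheses on the datum**
(Kang–Miura–Tsai 2021, Lemma 3.4; the tree's discharge `kangMiuraTsai_pressure_decomposition_holds`
does not use the datum hypotheses `v₀ ∈ E²`, `div v₀ = 0` of the named fact, and neither does
this transcription of its proof): for `x₀`, `r > 0`, `T > 0` there is `c ∈ L^{3/2}(0,T)` with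
`π = π_loc + π_far + c(t)` a.e. on `(0,T) × B_r(x₀)`.
[cite: KangMiuraTsai2020, Lemma 3.4 (pressure decomposition), arXiv:1812.10509 p. 8] -/
theorem pressure_decomposition_of_isLocalLeraySolution {ν : ℝ}
    {v₀ : EuclideanSpace ℝ (Fin 3) → EuclideanSpace ℝ (Fin 3)}
    {v : ℝ → EuclideanSpace ℝ (Fin 3) → EuclideanSpace ℝ (Fin 3)}
    {π : ℝ → EuclideanSpace ℝ (Fin 3) → ℝ} (hv : IsLocalLeraySolution ν v₀ v π)
    (x₀ : EuclideanSpace ℝ (Fin 3)) {r T : ℝ} (hr : 0 < r) (hT : 0 < T) :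
    ∃ c : ℝ → ℝ, MemLp c (3 / 2 : ℝ≥0∞) (volume.restrict (Ioo 0 T)) ∧
      ∀ᵐ z ∂(volume.restrict (Ioo 0 T ×ˢ ball x₀ r)),
        π z.1 z.2 = localPressureNear x₀ r v z.1 z.2 + localPressureFar x₀ r v z.1 z.2 + c z.1 := by
  set B : Set (EuclideanSpace ℝ (Fin 3)) := ball x₀ r with hB
  set μt : Measure ℝ := volume.restrict (Ioo (0 : ℝ) T) with hμt
  set μB : Measure (EuclideanSpace ℝ (Fin 3)) := volume.restrict B with hμB
  have hprod : μt.prod μB = volume.restrict (Ioo (0 : ℝ) T ×ˢ B) := by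
    rw [hμt, hμB, Measure.prod_restrict, ← Measure.volume_eq_prod]
  obtain ⟨c, hc, hslice⟩ := hv.exists_gauge hT x₀ hr
  refine ⟨c, hc, ?_⟩
  have hvT := hv.isLocalLeraySolutionOn T
  have hπm : AEStronglyMeasurable (uncurry π) (μt.prod μB) := hv.aestronglyMeasurable_pressure_box T B
  have hNm : AEStronglyMeasurable
      (fun z : ℝ × EuclideanSpace ℝ (Fin 3) => localPressureNear x₀ r v z.1 z.2) (μt.prod μB) :=
    (hvT.aestronglyMeasurable_localPressureNear x₀ r).mono_measure
      (Measure.prod_mono le_rfl Measure.restrict_le_self)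
  have hFam : AEStronglyMeasurable
      (fun z : ℝ × EuclideanSpace ℝ (Fin 3) => localPressureFar x₀ r v z.1 z.2) (μt.prod μB) :=
    (hvT.aestronglyMeasurable_localPressureFar x₀ r).mono_measure
      (Measure.prod_mono le_rfl Measure.restrict_le_self)
  have hcm : AEStronglyMeasurable (fun z : ℝ × EuclideanSpace ℝ (Fin 3) => c z.1) (μt.prod μB) :=
    hc.1.comp_fst
  set Φ : ℝ × EuclideanSpace ℝ (Fin 3) → ℝ := fun z =>
    π z.1 z.2 - (localPressureNear x₀ r v z.1 z.2 + localPressureFar x₀ r v z.1 z.2 + c z.1) with hΦ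
  have hΦm : AEStronglyMeasurable Φ (μt.prod μB) := hπm.sub ((hNm.add hFam).add hcm)
  have hE : MeasurableSet {z | hΦm.mk Φ z = 0} :=
    hΦm.stronglyMeasurable_mk.measurable (measurableSet_singleton 0)
  have h1 : Φ =ᵐ[μt.prod μB] hΦm.mk Φ := hΦm.ae_eq_mk
  have h2 : ∀ᵐ t ∂μt, ∀ᵐ x ∂μB, Φ (t, x) = hΦm.mk Φ (t, x) := Measure.ae_ae_of_ae_prod h1
  have h3 : ∀ᵐ t ∂μt, ∀ᵐ x ∂μB, (t, x) ∈ {z | hΦm.mk Φ z = 0} := by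
    filter_upwards [h2, hslice] with t ht hs
    filter_upwards [ht, hs] with x hx hsx
    show hΦm.mk Φ (t, x) = 0
    rw [← hx, hΦ]
    dsimp only
    rw [hsx]
    ring
  have h4 : ∀ᵐ z ∂μt.prod μB, z ∈ {z | hΦm.mk Φ z = 0} :=
    (Measure.ae_prod_mem_iff_ae_ae_mem hE).2 h3
  rw [← hprod]
  filter_upwards [h4, h1] with z hz hz1
  have hΦz : Φ z = 0 := by rw [hz1]; exact hz
  rw [hΦ] at hΦz
  dsimp only at hΦz
  linarith

/-- **A `T`-independent gauge** for the expansion at `x₀` with radius `r` (the ball mean of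
`π − π_loc − π_far`; cf. `exists_gauge_of_pressure_decomposition`, here without hypotheses on the
datum): `c ∈ L^{3/2}(0,T)` and `π − c = π_loc + π_far` a.e. on `(0,T) × B_r(x₀)` for every `T > 0`.
[cite: KangMiuraTsai2020, Lemma 3.4 (the gauge c_{x₀,r}), arXiv:1812.10509 p. 8] -/
theorem exists_gauge_of_isLocalLeraySolution {ν : ℝ}
    {v₀ : EuclideanSpace ℝ (Fin 3) → EuclideanSpace ℝ (Fin 3)}
    {v : ℝ → EuclideanSpace ℝ (Fin 3) → EuclideanSpace ℝ (Fin 3)}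
    {π : ℝ → EuclideanSpace ℝ (Fin 3) → ℝ} (hv : IsLocalLeraySolution ν v₀ v π)
    (x₀ : EuclideanSpace ℝ (Fin 3)) {r : ℝ} (hr : 0 < r) :
    ∃ c : ℝ → ℝ, ∀ T : ℝ, 0 < T →
      MemLp c (3 / 2 : ℝ≥0∞) (volume.restrict (Ioo 0 T)) ∧
      ∀ᵐ z ∂(volume.restrict (Ioo 0 T ×ˢ ball x₀ r)),
        π z.1 z.2 - c z.1 = localPressureNear x₀ r v z.1 z.2 + localPressureFar x₀ r v z.1 z.2 := by
  set N := localPressureNear x₀ r v with hN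
  set Fa := localPressureFar x₀ r v with hFa
  set B : Set (EuclideanSpace ℝ (Fin 3)) := ball x₀ r with hB
  refine ⟨fun t => ⨍ x in B, (π t x - N t x - Fa t x), fun T hT => ?_⟩
  obtain ⟨cT, hcT, hae⟩ := pressure_decomposition_of_isLocalLeraySolution hv x₀ hr hT
  set μt : Measure ℝ := volume.restrict (Ioo 0 T) with hμt
  set μB : Measure (EuclideanSpace ℝ (Fin 3)) := volume.restrict B with hμB
  have hprod : μt.prod μB = volume.restrict (Ioo 0 T ×ˢ B) := by
    rw [hμt, hμB, Measure.prod_restrict, ← Measure.volume_eq_prod]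
  have hB0 : volume B ≠ 0 := (measure_ball_pos volume x₀ hr).ne'
  have hBt : volume B ≠ ⊤ := measure_ball_lt_top.ne
  have hae' : ∀ᵐ z ∂μt.prod μB, π z.1 z.2 = N z.1 z.2 + Fa z.1 z.2 + cT z.1 := by
    rw [hprod]
    exact hae
  have hslice : ∀ᵐ t ∂μt, ∀ᵐ x ∂μB, π t x = N t x + Fa t x + cT t :=
    Measure.ae_ae_of_ae_prod hae'
  have hgauge : (fun t => ⨍ x in B, (π t x - N t x - Fa t x)) =ᵐ[μt] cT := by
    filter_upwards [hslice] with t ht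
    have h1 : (fun x => π t x - N t x - Fa t x) =ᵐ[μB] fun _ => cT t := by
      filter_upwards [ht] with x hx
      rw [hx]
      ring
    show ⨍ x, (π t x - N t x - Fa t x) ∂μB = cT t
    rw [average_congr h1, hμB]
    exact setAverage_const hB0 hBt _
  refine ⟨hcT.ae_eq hgauge.symm, ?_⟩
  have hfst : (fun z : ℝ × EuclideanSpace ℝ (Fin 3) => ⨍ x in B, (π z.1 x - N z.1 x - Fa z.1 x))
      =ᵐ[μt.prod μB] fun z => cT z.1 :=
    Measure.QuasiMeasurePreserving.ae_eq Measure.quasiMeasurePreserving_fst hgauge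
  rw [← hprod]
  filter_upwards [hae', hfst] with z h1 h2
  rw [h2, h1]
  ring

/-- **Renormalising the pressure by the gauge of the expansion at the origin.** Every local Leray
solution `(v, π)` admits a second pressure `π' = π − c(t)` (`c` a measurable gauge in
`L^{3/2}_loc([0,∞))`) with `(v, π')` again a local Leray solution and
`π' = π_loc + π_far` a.e. on `(0,T) × B_r(0)` for every `T > 0` (expansion at the centre `0` with
radius `r`): the pressure of a local Leray solution is determined up to functions of time
(`IsLocalLeraySolution.sub_pressure`). [cite: KangMiuraTsai2020, Lemma 3.4 (pressure decomposition and the gauge), arXiv:1812.10509 p. 8] -/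
theorem exists_originGaugedPressure {ν : ℝ}
    {v₀ : EuclideanSpace ℝ (Fin 3) → EuclideanSpace ℝ (Fin 3)}
    {v : ℝ → EuclideanSpace ℝ (Fin 3) → EuclideanSpace ℝ (Fin 3)}
    {π : ℝ → EuclideanSpace ℝ (Fin 3) → ℝ} (hv : IsLocalLeraySolution ν v₀ v π)
    {r : ℝ} (hr : 0 < r) :
    ∃ π' : ℝ → EuclideanSpace ℝ (Fin 3) → ℝ, IsLocalLeraySolution ν v₀ v π' ∧
      ∀ T : ℝ, 0 < T → ∀ᵐ z ∂(volume.restrict (Ioo 0 T ×ˢ ball (0 : EuclideanSpace ℝ (Fin 3)) r)),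
        π' z.1 z.2 = localPressureNear 0 r v z.1 z.2 + localPressureFar 0 r v z.1 z.2 := by
  obtain ⟨g, hg⟩ := exists_gauge_of_isLocalLeraySolution hv 0 hr
  -- a measurable modification of the gauge on `(0, ∞)`
  have hU : (⋃ n : ℕ, Ioo (0 : ℝ) ((n : ℝ) + 1)) = Ioi 0 := by
    ext t
    simp only [mem_iUnion, mem_Ioo, mem_Ioi]
    constructor
    · rintro ⟨n, h0, -⟩; exact h0
    · intro h0
      obtain ⟨n, hn⟩ := exists_nat_gt t
      exact ⟨n, h0, hn.trans (lt_add_one _)⟩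
  have hgm : AEStronglyMeasurable g (volume.restrict (Ioi (0 : ℝ))) := by
    rw [← hU, aestronglyMeasurable_iUnion_iff]
    intro n
    exact (hg ((n : ℝ) + 1) (by positivity)).1.aestronglyMeasurable
  set c : ℝ → ℝ := hgm.mk g with hcdef
  have hcmeas : Measurable c := hgm.stronglyMeasurable_mk.measurable
  have hgc : g =ᵐ[volume.restrict (Ioi (0 : ℝ))] c := hgm.ae_eq_mk
  have hgcT : ∀ T : ℝ, g =ᵐ[volume.restrict (Ioo (0 : ℝ) T)] c := fun T =>
    ae_restrict_of_ae_restrict_of_subset Ioo_subset_Ioi_self hgc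
  have hcT : ∀ T : ℝ, 0 < T → MemLp c (3 / 2 : ℝ≥0∞) (volume.restrict (Ioo 0 T)) := fun T hT =>
    (hg T hT).1.ae_eq (hgcT T)
  -- the decomposition with the modified gauge
  have hdec : ∀ T : ℝ, 0 < T →
      ∀ᵐ z ∂(volume.restrict (Ioo 0 T ×ˢ ball (0 : EuclideanSpace ℝ (Fin 3)) r)),
        π z.1 z.2 - c z.1 = localPressureNear 0 r v z.1 z.2 + localPressureFar 0 r v z.1 z.2 := by
    intro T hT
    have hprod : (volume.restrict (Ioo (0 : ℝ) T)).prod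
        (volume.restrict (ball (0 : EuclideanSpace ℝ (Fin 3)) r)) =
        volume.restrict (Ioo 0 T ×ˢ ball (0 : EuclideanSpace ℝ (Fin 3)) r) := by
      rw [Measure.prod_restrict, ← Measure.volume_eq_prod]
    have hfst : (fun z : ℝ × EuclideanSpace ℝ (Fin 3) => g z.1)
        =ᵐ[(volume.restrict (Ioo (0 : ℝ) T)).prod
          (volume.restrict (ball (0 : EuclideanSpace ℝ (Fin 3)) r))] fun z => c z.1 :=
      Measure.QuasiMeasurePreserving.ae_eq Measure.quasiMeasurePreserving_fst (hgcT T)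
    rw [hprod] at hfst
    filter_upwards [(hg T hT).2, hfst] with z hz hz'
    rw [← hz', hz]
  -- finiteness of `π − c` in `L^{3/2}` on the boxes
  have hπm := hv.aestronglyMeasurable_pressure
  have hfin : ∀ T R : ℝ, 0 < T → 0 < R →
      ∫⁻ z in Ioo 0 T ×ˢ ball (0 : EuclideanSpace ℝ (Fin 3)) R, ‖π z.1 z.2 - c z.1‖ₑ ^ (3 / 2 : ℝ) < ⊤ := by
    intro T R hT hR
    set S : Set (ℝ × EuclideanSpace ℝ (Fin 3)) := Ioo 0 T ×ˢ ball (0 : EuclideanSpace ℝ (Fin 3)) R with hS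
    have hcS : Measurable fun z : ℝ × EuclideanSpace ℝ (Fin 3) => ‖c z.1‖ₑ ^ (3 / 2 : ℝ) :=
      (hcmeas.comp measurable_fst).enorm.pow_const _
    have h1 : ∫⁻ z in S, ‖π z.1 z.2‖ₑ ^ (3 / 2 : ℝ) < ⊤ :=
      (lintegral_mono_set (Set.prod_mono le_rfl ball_subset_closedBall)).trans_lt
        (hv.pressure T hT _ (isCompact_closedBall _ _))
    have h2 : ∫⁻ z in S, ‖c z.1‖ₑ ^ (3 / 2 : ℝ) < ⊤ := by
      rw [hS, lintegral_prod_of_time_only (hcmeas.enorm.pow_const _) (Ioo 0 T)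
        (ball (0 : EuclideanSpace ℝ (Fin 3)) R)]
      refine ENNReal.mul_lt_top ?_ measure_ball_lt_top
      have hmem := hcT T hT
      have e : ((3 / 2 : ℝ≥0∞)).toReal = (3 / 2 : ℝ) := by
        rw [ENNReal.toReal_div]; norm_num
      have h := (eLpNorm_lt_top_iff_lintegral_rpow_enorm_lt_top (by norm_num)
        (ENNReal.div_ne_top (by norm_num) (by norm_num))).1 hmem.eLpNorm_lt_top
      rw [e] at h
      exact h
    calc ∫⁻ z in S, ‖π z.1 z.2 - c z.1‖ₑ ^ (3 / 2 : ℝ)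
        ≤ ∫⁻ z in S, (2 : ℝ≥0∞) ^ (1 / 2 : ℝ) * (‖π z.1 z.2‖ₑ ^ (3 / 2 : ℝ) + ‖c z.1‖ₑ ^ (3 / 2 : ℝ)) :=
          lintegral_mono fun z => enorm_sub_rpow_threeHalves_le _ _
      _ = (2 : ℝ≥0∞) ^ (1 / 2 : ℝ) * ((∫⁻ z in S, ‖π z.1 z.2‖ₑ ^ (3 / 2 : ℝ)) +
            ∫⁻ z in S, ‖c z.1‖ₑ ^ (3 / 2 : ℝ)) := by
          rw [lintegral_const_mul' _ _ (ENNReal.rpow_ne_top_of_nonneg (by norm_num) ENNReal.ofNat_ne_top),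
            lintegral_add_right _ hcS]
      _ < ⊤ := ENNReal.mul_lt_top (ENNReal.rpow_lt_top_of_nonneg (by norm_num) ENNReal.ofNat_ne_top)
          (ENNReal.add_lt_top.2 ⟨h1, h2⟩)
  exact ⟨fun t x => π t x - c t, hv.sub_pressure hcmeas hfin, hdec⟩

/-! ## Small tools for the energy estimate -/

/-- **Absorption**: `a + 2D ≤ b + D` with `D < ∞` gives `a + D ≤ b` ("Provided `γ` is small
enough, the gradient term can be absorbed into the left hand side", Bradshaw–Tsai 2019, p. 9).
[cite: BradshawTsai2019, §3 p. 9 (absorption)] -/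
private theorem add_le_of_add_two_mul_le' {a b D : ℝ≥0∞} (hD : D ≠ ⊤) (h : a + 2 * D ≤ b + D) :
    a + D ≤ b := by
  rw [two_mul, ← add_assoc] at h
  exact (ENNReal.add_le_add_iff_right hD).1 h

/-- Young for the pressure–velocity product: `xy ≤ x^{3/2} + y³` in `ℝ≥0∞` (exponents `3/2`, `3`).
[folklore] -/
private theorem mul_le_rpow_threeHalves_add_rpow_three (x y : ℝ≥0∞) :
    x * y ≤ x ^ (3 / 2 : ℝ) + y ^ (3 : ℝ) := by
  have hpq : (3 / 2 : ℝ).HolderConjugate 3 := Real.holderConjugate_iff.2 ⟨by norm_num, by norm_num⟩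
  refine (ENNReal.young_inequality x y hpq).trans (add_le_add ?_ ?_)
  · exact ENNReal.div_le_of_le_mul (le_mul_of_one_le_right' (by
      rw [← ENNReal.ofReal_one]; exact ENNReal.ofReal_le_ofReal (by norm_num)))
  · exact ENNReal.div_le_of_le_mul (le_mul_of_one_le_right' (by
      rw [← ENNReal.ofReal_one]; exact ENNReal.ofReal_le_ofReal (by norm_num)))

/-- An integral over a time slab `I × ℝ³` of a function vanishing off `I × B` is at most the
integral over `I × B` of any larger function. [folklore] -/
theorem setLIntegral_timeSlab_le_of_eq_zero_off {F G : ℝ × EuclideanSpace ℝ (Fin 3) → ℝ≥0∞}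
    {I : Set ℝ} (hI : MeasurableSet I) {B : Set (EuclideanSpace ℝ (Fin 3))} (hB : MeasurableSet B)
    (hle : ∀ z ∈ I ×ˢ B, F z ≤ G z) (h0 : ∀ z ∈ I ×ˢ Bᶜ, F z = 0) :
    ∫⁻ z in I ×ˢ (univ : Set (EuclideanSpace ℝ (Fin 3))), F z ≤ ∫⁻ z in I ×ˢ B, G z := by
  have hU : I ×ˢ (univ : Set (EuclideanSpace ℝ (Fin 3))) = I ×ˢ B ∪ I ×ˢ Bᶜ := by
    rw [← prod_union, union_compl_self]
  calc ∫⁻ z in I ×ˢ (univ : Set (EuclideanSpace ℝ (Fin 3))), F z = ∫⁻ z in I ×ˢ B ∪ I ×ˢ Bᶜ, F z := by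
        rw [hU]
    _ ≤ (∫⁻ z in I ×ˢ B, F z) + ∫⁻ z in I ×ˢ Bᶜ, F z := lintegral_union_le _ _ _
    _ = (∫⁻ z in I ×ˢ B, F z) + ∫⁻ z in I ×ˢ Bᶜ, (0 : ℝ≥0∞) := by
        rw [setLIntegral_congr_fun (hI.prod hB.compl) h0]
    _ ≤ ∫⁻ z in I ×ˢ B, G z := by
        rw [lintegral_zero, add_zero]; exact setLIntegral_mono' (hI.prod hB) hle

/-- **The cut-off `χ` of p. 8** ("Fix `χ ∈ C^∞(ℝ)` with `χ(t) = 1` if `t ≤ 1` and `χ(t) = 0` if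
`t ≥ λ`"; radial on `ℝ³`, supported strictly inside `B_λ`): for `1 < λ` a smooth `χ` with
`0 ≤ χ ≤ 1`, `χ = 1` on `B₁`, `χ = 0` off `B_{(1+λ)/2}`, of compact support (Mathlib's
`ContDiffBump`). [cite: BradshawTsai2019, §3 proof of Prop 3.1 (p. 8, the cut-off χ)] -/
theorem exists_unitBall_cutoff {c : ℝ} (hc : 1 < c) :
    ∃ χ : EuclideanSpace ℝ (Fin 3) → ℝ, ContDiff ℝ (⊤ : ℕ∞) χ ∧ HasCompactSupport χ ∧
      (∀ x, 0 ≤ χ x ∧ χ x ≤ 1) ∧ (∀ x ∈ ball (0 : EuclideanSpace ℝ (Fin 3)) 1, χ x = 1) ∧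
      (∀ x, (1 + c) / 2 ≤ ‖x‖ → χ x = 0) := by
  have key : ∀ f : ContDiffBump (0 : EuclideanSpace ℝ (Fin 3)), f.rIn = 1 → f.rOut = (1 + c) / 2 →
      ∃ χ : EuclideanSpace ℝ (Fin 3) → ℝ, ContDiff ℝ (⊤ : ℕ∞) χ ∧ HasCompactSupport χ ∧
        (∀ x, 0 ≤ χ x ∧ χ x ≤ 1) ∧ (∀ x ∈ ball (0 : EuclideanSpace ℝ (Fin 3)) 1, χ x = 1) ∧
        (∀ x, (1 + c) / 2 ≤ ‖x‖ → χ x = 0) := by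
    intro f hIn hOut
    refine ⟨f, f.contDiff, f.hasCompactSupport, fun x => ⟨f.nonneg, f.le_one⟩, fun x hx => ?_,
      fun x hx => ?_⟩
    · exact f.one_of_mem_closedBall (by rw [hIn]; exact ball_subset_closedBall hx)
    · exact f.zero_of_le_dist (by rw [hOut, dist_zero_right]; exact hx)
  exact key ⟨1, (1 + c) / 2, one_pos, by linarith⟩ rfl rfl

/-- **The flux integrand of the local energy inequality in absolute value**: for `a, g ∈ ℝ³` and
reals `ν, L, p`,
`‖|a|²(νL) + (|a|² + 2p)⟨a,g⟩‖ ≤ ‖ν‖ |a|²|L| + |a|³|g| + 2|p||a||g|` (Cauchy–Schwarz). [folklore] -/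
theorem enorm_lei_flux_le (a g : EuclideanSpace ℝ (Fin 3)) (ν L p : ℝ) :
    ‖‖a‖ ^ 2 * (ν * L) + (‖a‖ ^ 2 + 2 * p) * ⟪a, g⟫‖ₑ ≤
      ‖ν‖ₑ * (‖a‖ₑ ^ 2 * ‖L‖ₑ) + ‖a‖ₑ ^ 2 * ‖a‖ₑ * ‖g‖ₑ + 2 * ‖p‖ₑ * ‖a‖ₑ * ‖g‖ₑ := by
  have hsq : ‖(‖a‖ ^ 2 : ℝ)‖ₑ = ‖a‖ₑ ^ 2 := by
    rw [Real.enorm_eq_ofReal (sq_nonneg _), ENNReal.ofReal_pow (norm_nonneg _), ofReal_norm]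
  have hin : ‖(⟪a, g⟫ : ℝ)‖ₑ ≤ ‖a‖ₑ * ‖g‖ₑ := by
    rw [Real.enorm_eq_ofReal_abs, ← ofReal_norm, ← ofReal_norm,
      ← ENNReal.ofReal_mul (norm_nonneg _)]
    exact ENNReal.ofReal_le_ofReal (abs_real_inner_le_norm a g)
  have h2 : ‖(2 : ℝ)‖ₑ = 2 := by
    rw [Real.enorm_eq_ofReal zero_le_two, ENNReal.ofReal_ofNat]
  calc ‖‖a‖ ^ 2 * (ν * L) + (‖a‖ ^ 2 + 2 * p) * ⟪a, g⟫‖ₑ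
      ≤ ‖‖a‖ ^ 2 * (ν * L)‖ₑ + ‖(‖a‖ ^ 2 + 2 * p) * ⟪a, g⟫‖ₑ := enorm_add_le _ _
    _ = ‖ν‖ₑ * (‖a‖ₑ ^ 2 * ‖L‖ₑ) + ‖(‖a‖ ^ 2 + 2 * p : ℝ)‖ₑ * ‖(⟪a, g⟫ : ℝ)‖ₑ := by
        rw [enorm_mul, enorm_mul, enorm_mul, hsq]
        ring
    _ ≤ ‖ν‖ₑ * (‖a‖ₑ ^ 2 * ‖L‖ₑ) + (‖a‖ₑ ^ 2 + 2 * ‖p‖ₑ) * (‖a‖ₑ * ‖g‖ₑ) := by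
        gcongr
        calc ‖(‖a‖ ^ 2 + 2 * p : ℝ)‖ₑ ≤ ‖(‖a‖ ^ 2 : ℝ)‖ₑ + ‖(2 * p : ℝ)‖ₑ := enorm_add_le _ _
          _ = ‖a‖ₑ ^ 2 + 2 * ‖p‖ₑ := by rw [hsq, enorm_mul, h2]
    _ = ‖ν‖ₑ * (‖a‖ₑ ^ 2 * ‖L‖ₑ) + ‖a‖ₑ ^ 2 * ‖a‖ₑ * ‖g‖ₑ + 2 * ‖p‖ₑ * ‖a‖ₑ * ‖g‖ₑ := by ring

/-! ## The energy envelope of a DSS local Leray solution (Bradshaw–Tsai 2019, (3.7)–(3.12)) -/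

/-- **The a priori energy inequality (3.12) for an arbitrary `λ`-DSS local Leray solution**
(Bradshaw–Tsai 2019, §3, proof of Prop. 3.1, (3.7)–(3.12) and the pressure bounds of p. 10 —
run on the local Leray solution itself rather than on mollified approximants). Fix `λ = c > 1`.
There are `C₀ = C₀(λ)` and `C_p = C_p(λ)` such that for every local Leray solution `(v, π)`
(viscosity `1`, measurable datum `v₀`) with `v` `λ`-DSS, whose pressure is the gauged one of the
local expansion at the origin with radius `λ` (`π = π_loc + π_far` a.e. on `(0,T) × B_λ`,
`exists_originGaugedPressure`), and for every monotone majorant `A` of `α(t) = ∫_{B₁}|v(t)|²`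
(`α ≤ A` a.e.): with the weak gradient `G = ∇v` of the class,
(i) for a.e. `s ∈ (0,1)`, `α(s) + ∫₀ˢ∫_{B₁}|∇v|² ≤ ‖v₀‖²_{L²(B_λ)} + C₀ ∫₀ˢ (A + A³)`
(the local energy inequality from `t = 0` with the weight `φ = χ²`; the second term by (3.6);
the cubic term by (3.6), Gagliardo–Nirenberg on `B₁` and Young; the pressure term by Young,
Calderón–Zygmund for `π_loc` and the `λ`-adic shell sum for `π_far`; absorption of the gradient
terms, the dissipation on `(0,1) × B_λ` being finite in the local Leray class);
(ii) for `0 < s ≤ 1`, `∫₀ˢ∫_{B₁}|π|^{3/2} ≤ C_p (∫₀ˢ(A + A³) + ∫₀ˢ∫_{B₁}|∇v|²)`.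
[cite: BradshawTsai2019, §3 proof of Prop 3.1 ((3.7)–(3.12), pressure bounds p. 10)] -/
theorem exists_energy_envelope {c : ℝ} (hc : 1 < c) :
    ∃ C₀ : ℝ≥0∞, C₀ ≠ ⊤ ∧ ∃ Cp : ℝ≥0∞, Cp ≠ ⊤ ∧
      ∀ (v₀ : EuclideanSpace ℝ (Fin 3) → EuclideanSpace ℝ (Fin 3))
        (v : ℝ → EuclideanSpace ℝ (Fin 3) → EuclideanSpace ℝ (Fin 3))
        (π : ℝ → EuclideanSpace ℝ (Fin 3) → ℝ) (A : ℝ → ℝ≥0∞),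
        AEStronglyMeasurable v₀ volume → IsLocalLeraySolution 1 v₀ v π →
        IsDiscretelySelfSimilar c v →
        (∀ T : ℝ, 0 < T →
          ∀ᵐ z ∂(volume.restrict (Ioo 0 T ×ˢ ball (0 : EuclideanSpace ℝ (Fin 3)) c)),
            π z.1 z.2 = localPressureNear 0 c v z.1 z.2 + localPressureFar 0 c v z.1 z.2) →
        Monotone A → (∀ᵐ t : ℝ, 0 < t → ballEnergy v t ≤ A t) →
        ∃ G : ℝ → EuclideanSpace ℝ (Fin 3) → EuclideanSpace ℝ (Fin 3) →L[ℝ] EuclideanSpace ℝ (Fin 3),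
          HasWeakSpatialGradientOn (slab (EuclideanSpace ℝ (Fin 3)) (Ioi 0) isOpen_Ioi) v G ∧
          (∀ᵐ s ∂(volume.restrict (Ioo (0 : ℝ) 1)),
            ballEnergy v s + ∫⁻ z in Ioo 0 s ×ˢ ball (0 : EuclideanSpace ℝ (Fin 3)) 1,
                ENNReal.ofReal (frobeniusNormSq (G z.1 z.2)) ≤
              (∫⁻ x in ball (0 : EuclideanSpace ℝ (Fin 3)) c, ‖v₀ x‖ₑ ^ 2) +
                C₀ * ∫⁻ σ in Ioo 0 s, (A σ + A σ ^ 3)) ∧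
          (∀ s : ℝ, 0 < s → s ≤ 1 →
            ∫⁻ z in Ioo 0 s ×ˢ ball (0 : EuclideanSpace ℝ (Fin 3)) 1, ‖π z.1 z.2‖ₑ ^ (3 / 2 : ℝ) ≤
              Cp * ((∫⁻ σ in Ioo 0 s, (A σ + A σ ^ 3)) +
                ∫⁻ z in Ioo 0 s ×ˢ ball (0 : EuclideanSpace ℝ (Fin 3)) 1,
                  ENNReal.ofReal (frobeniusNormSq (G z.1 z.2)))) := by
  have hc0 : 0 < c := zero_lt_one.trans hc
  -- ### absolute constants: Calderón–Zygmund, the kernel, the far field, the cubic term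
  obtain ⟨Cn, hCn0, hCntop, hnear⟩ :=
    exists_lintegral_localPressureNear_le stein1970_normalisedPressure_ae_Lp_bound_holds
  obtain ⟨CK, hCK0, hCK⟩ := exists_abs_pressureKernel_sub_le
  obtain ⟨Kf, hKft, hfarAll⟩ := exists_farField_le_majorant hc
  obtain ⟨Cc, hCc0, hCct, hcubeAll⟩ := exists_cubic_unitCylinder_le_of_majorant
  obtain ⟨m, hm⟩ : ∃ m : ℕ, 2 * c ≤ c ^ m :=
    (pow_unbounded_of_one_lt (2 * c) hc).imp fun _ h => h.le
  have hcm1 : 1 < c ^ m := lt_of_lt_of_le (by linarith) hm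
  -- ### the cut-off `φ = χ²`
  obtain ⟨χ, hχs, hχcs, hχ01, hχB, hχc⟩ := exists_unitBall_cutoff hc
  have hψs : ContDiff ℝ (⊤ : ℕ∞) (fun x => χ x ^ 2) := hχs.pow 2
  have hψcs : HasCompactSupport (fun x => χ x ^ 2) :=
    hχcs.comp_left (g := fun r : ℝ => r ^ 2) (zero_pow two_ne_zero)
  have hψ0 : ∀ x, 0 ≤ χ x ^ 2 := fun x => sq_nonneg _
  have hψ1 : ∀ x, χ x ^ 2 ≤ 1 := fun x => pow_le_one₀ (hχ01 x).1 (hχ01 x).2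
  have hψB : ∀ x ∈ ball (0 : EuclideanSpace ℝ (Fin 3)) 1, χ x ^ 2 = 1 := fun x hx => by
    rw [hχB x hx, one_pow]
  have hψc : ∀ x, x ∉ ball (0 : EuclideanSpace ℝ (Fin 3)) c → χ x ^ 2 = 0 := fun x hx => by
    rw [mem_ball_zero_iff, not_lt] at hx
    rw [hχc x (by linarith), zero_pow two_ne_zero]
  have hts : tsupport (fun x => χ x ^ 2) ⊆ ball (0 : EuclideanSpace ℝ (Fin 3)) c := by
    refine (closure_minimal (fun x hx => ?_) isClosed_closedBall).trans
      (closedBall_subset_ball (by linarith : (1 + c) / 2 < c))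
    rw [mem_closedBall_zero_iff]
    by_contra h'
    exact hx (by simp [hχc x (not_le.1 h').le])
  have hΔ0 : ∀ x, x ∉ ball (0 : EuclideanSpace ℝ (Fin 3)) c → (Δ (fun x => χ x ^ 2)) x = 0 :=
    fun x hx => laplacian_eq_zero_of_notMem_tsupport fun h' => hx (hts h')
  have hg0 : ∀ x, x ∉ ball (0 : EuclideanSpace ℝ (Fin 3)) c → gradient (fun x => χ x ^ 2) x = 0 :=
    fun x hx => gradient_eq_zero_of_notMem_tsupport fun h' => hx (hts h')
  have hψ2 : ContDiff ℝ 2 (fun x => χ x ^ 2) := hψs.of_le (by norm_cast)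
  have hψ1' : ContDiff ℝ 1 (fun x => χ x ^ 2) := hψ2.of_le one_le_two
  have hΔc : Continuous (Δ (fun x => χ x ^ 2)) := continuous_laplacian hψ2
  have hgc : Continuous (gradient (fun x => χ x ^ 2)) := continuous_gradient_of_contDiff hψ1'
  obtain ⟨MΔ, hMΔ⟩ := hψcs.isCompact.exists_bound_of_continuousOn hΔc.continuousOn
  obtain ⟨Mg, hMg⟩ := hψcs.isCompact.exists_bound_of_continuousOn hgc.continuousOn
  have eΔ : ∀ x, ‖(Δ (fun x => χ x ^ 2)) x‖ₑ ≤ ENNReal.ofReal MΔ := fun x => by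
    by_cases hx : x ∈ tsupport (fun x => χ x ^ 2)
    · rw [← ofReal_norm]; exact ENNReal.ofReal_le_ofReal (hMΔ x hx)
    · simp [laplacian_eq_zero_of_notMem_tsupport hx]
  have eg : ∀ x, ‖gradient (fun x => χ x ^ 2) x‖ₑ ≤ ENNReal.ofReal Mg := fun x => by
    by_cases hx : x ∈ tsupport (fun x => χ x ^ 2)
    · rw [← ofReal_norm]; exact ENNReal.ofReal_le_ofReal (hMg x hx)
    · simp [gradient_eq_zero_of_notMem_tsupport hx]
  -- ### the constants
  set K₁ : ℝ≥0∞ := ENNReal.ofReal MΔ * ENNReal.ofReal c with hK₁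
  set K₂ : ℝ≥0∞ := ENNReal.ofReal Mg with hK₂
  set K₃ : ℝ≥0∞ := 2 * ENNReal.ofReal Mg with hK₃
  set c2 : ℝ≥0∞ := ENNReal.ofReal (c ^ 2) with hc2
  set cm2 : ℝ≥0∞ := ENNReal.ofReal ((c ^ m) ^ 2) with hcm2
  set s2 : ℝ≥0∞ := (2 : ℝ≥0∞) ^ (1 / 2 : ℝ) with hs2
  set VB : ℝ≥0∞ := volume (ball (0 : EuclideanSpace ℝ (Fin 3)) c) with hVB
  set cK : ℝ≥0∞ := ENNReal.ofReal (CK * c) with hcK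
  set Pfar : ℝ≥0∞ := s2 * VB * (cK * Kf) ^ (3 / 2 : ℝ) with hPfar
  set S : ℝ≥0∞ := (K₂ * c2 + K₃ * c2 + K₃ * (s2 * Cn * cm2)) * Cc with hS
  have hK₁t : K₁ ≠ ⊤ := ENNReal.mul_ne_top ENNReal.ofReal_ne_top ENNReal.ofReal_ne_top
  have hK₂t : K₂ ≠ ⊤ := ENNReal.ofReal_ne_top
  have hK₃t : K₃ ≠ ⊤ := ENNReal.mul_ne_top (by norm_num) ENNReal.ofReal_ne_top
  have hc2t : c2 ≠ ⊤ := ENNReal.ofReal_ne_top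
  have hcm2t : cm2 ≠ ⊤ := ENNReal.ofReal_ne_top
  have hs2t : s2 ≠ ⊤ := ENNReal.rpow_ne_top_of_nonneg (by norm_num) ENNReal.ofNat_ne_top
  have hVBt : VB ≠ ⊤ := measure_ball_lt_top.ne
  have hcKt : cK ≠ ⊤ := ENNReal.ofReal_ne_top
  have hPfart : Pfar ≠ ⊤ := ENNReal.mul_ne_top (ENNReal.mul_ne_top hs2t hVBt)
    (ENNReal.rpow_ne_top_of_nonneg (by norm_num) (ENNReal.mul_ne_top hcKt hKft))
  have hSt : S ≠ ⊤ := ENNReal.mul_ne_top (ENNReal.add_ne_top.2 ⟨ENNReal.add_ne_top.2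
    ⟨ENNReal.mul_ne_top hK₂t hc2t, ENNReal.mul_ne_top hK₃t hc2t⟩,
    ENNReal.mul_ne_top hK₃t (ENNReal.mul_ne_top (ENNReal.mul_ne_top hs2t hCntop) hcm2t)⟩) hCct
  have hS1t : S + 1 ≠ ⊤ := ENNReal.add_ne_top.2 ⟨hSt, ENNReal.one_ne_top⟩
  have hS10 : S + 1 ≠ 0 := ne_of_gt (lt_of_lt_of_le zero_lt_one le_add_self)
  set γ : ℝ≥0∞ := (S + 1)⁻¹ with hγ
  have hγ0 : γ ≠ 0 := ENNReal.inv_ne_zero.2 hS1t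
  have hγt : γ ≠ ⊤ := ENNReal.inv_ne_top.2 hS10
  have hγS : S * γ ≤ 1 := by
    calc S * γ ≤ (S + 1) * γ := mul_le_mul' le_self_add le_rfl
      _ = 1 := ENNReal.mul_inv_cancel hS10 hS1t
  set gi : ℝ≥0∞ := 1 + (γ⁻¹) ^ 3 with hgi
  have hgit : gi ≠ ⊤ := by
    rw [hgi, hγ, inv_inv]
    exact ENNReal.add_ne_top.2 ⟨ENNReal.one_ne_top, ENNReal.pow_ne_top hS1t⟩
  have h1gi : 1 ≤ gi := le_self_add
  set C' : ℝ≥0∞ := K₁ + K₃ * Pfar + S * gi with hC'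
  have hC't : C' ≠ ⊤ := ENNReal.add_ne_top.2 ⟨ENNReal.add_ne_top.2 ⟨hK₁t, ENNReal.mul_ne_top hK₃t hPfart⟩,
    ENNReal.mul_ne_top hSt hgit⟩
  set Cp : ℝ≥0∞ := s2 * Cn * cm2 * (2 * Cc) + Pfar with hCp
  have hCpt : Cp ≠ ⊤ := ENNReal.add_ne_top.2 ⟨ENNReal.mul_ne_top (ENNReal.mul_ne_top
    (ENNReal.mul_ne_top hs2t hCntop) hcm2t) (ENNReal.mul_ne_top (by norm_num) hCct), hPfart⟩
  refine ⟨C', hC't, Cp, hCpt, ?_⟩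
  -- ### the solution
  intro v₀ v π A hm₀ hv hdss hdec hA hαA
  obtain ⟨G, hG, hGb⟩ := hv.uniformLocalGradient
  obtain ⟨CG, hCG⟩ := hGb c hc0
  have hAm : Measurable A := hA.measurable
  have hvT : IsLocalLeraySolutionOn 1 1 v₀ v π := hv.isLocalLeraySolutionOn 1
  have hslab : (slab (EuclideanSpace ℝ (Fin 3)) (Ioo 0 1) isOpen_Ioo) ≤
      slab (EuclideanSpace ℝ (Fin 3)) (Ioi 0) isOpen_Ioi := slab_mono Ioo_subset_Ioi_self
  have hG1 : HasWeakSpatialGradientOn (slab (EuclideanSpace ℝ (Fin 3)) (Ioo 0 1) isOpen_Ioo) v G :=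
    hG.mono hslab
  have hvm1 : AEStronglyMeasurable (uncurry v)
      (volume.restrict (Ioo (0 : ℝ) 1 ×ˢ (univ : Set (EuclideanSpace ℝ (Fin 3))))) :=
    hvT.aestronglyMeasurable
  have hvmI : AEStronglyMeasurable (uncurry v)
      (volume.restrict (Ioi (0 : ℝ) ×ˢ (univ : Set (EuclideanSpace ℝ (Fin 3))))) :=
    hv.aestronglyMeasurable
  have hπm := hv.aestronglyMeasurable_pressure
  have hcube := hcubeAll 1 v G A hvm1 hG1 hA hαA
  have hfar := hfarAll v A hdss hA hαA
  -- measurability on boxes `(0,s) × B`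
  have hsubI : ∀ (s : ℝ) (B : Set (EuclideanSpace ℝ (Fin 3))),
      Ioo (0 : ℝ) s ×ˢ B ⊆ Ioi (0 : ℝ) ×ˢ (univ : Set (EuclideanSpace ℝ (Fin 3))) := fun s B =>
    Set.prod_mono Ioo_subset_Ioi_self (subset_univ _)
  have mvB : ∀ (s : ℝ) (B : Set (EuclideanSpace ℝ (Fin 3))),
      AEStronglyMeasurable (fun z : ℝ × EuclideanSpace ℝ (Fin 3) => v z.1 z.2)
        (volume.restrict (Ioo (0 : ℝ) s ×ˢ B)) := fun s B =>
    hvmI.mono_measure (Measure.restrict_mono (hsubI s B) le_rfl)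
  have mπB : ∀ (s : ℝ) (B : Set (EuclideanSpace ℝ (Fin 3))),
      AEStronglyMeasurable (fun z : ℝ × EuclideanSpace ℝ (Fin 3) => π z.1 z.2)
        (volume.restrict (Ioo (0 : ℝ) s ×ˢ B)) := fun s B =>
    hπm.mono_measure (Measure.restrict_mono (hsubI s B) le_rfl)
  -- ### (3.6): the energy on `B_c`, slice-wise and on the cylinder
  have hX2slice : ∀ᵐ τ : ℝ, 0 < τ →
      ∫⁻ x in ball (0 : EuclideanSpace ℝ (Fin 3)) c, ‖v τ x‖ₑ ^ 2 ≤ ENNReal.ofReal c * A τ := by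
    have hκ : 0 < (c ^ 2)⁻¹ := by positivity
    filter_upwards [ae_pos_comp_mul_left hαA hκ] with τ hτ h0
    rw [setLIntegral_ball_enorm_sq_eq_ballEnergy hc0 hdss τ]
    refine mul_le_mul' le_rfl ((hτ h0).trans (hA ?_))
    have h1 : (c ^ 2)⁻¹ ≤ 1 := inv_le_one_of_one_le₀ (one_le_pow₀ hc.le)
    calc (c ^ 2)⁻¹ * τ ≤ 1 * τ := mul_le_mul_of_nonneg_right h1 h0.le
      _ = τ := one_mul τ
  have hX2 : ∀ s : ℝ, ∫⁻ z in Ioo 0 s ×ˢ ball (0 : EuclideanSpace ℝ (Fin 3)) c, ‖v z.1 z.2‖ₑ ^ 2 ≤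
      ENNReal.ofReal c * ∫⁻ τ in Ioo 0 s, A τ := by
    intro s
    calc ∫⁻ z in Ioo 0 s ×ˢ ball (0 : EuclideanSpace ℝ (Fin 3)) c, ‖v z.1 z.2‖ₑ ^ 2
        ≤ ∫⁻ τ in Ioo 0 s, ∫⁻ x in ball (0 : EuclideanSpace ℝ (Fin 3)) c, ‖v τ x‖ₑ ^ 2 := by
          rw [Measure.volume_eq_prod, ← Measure.prod_restrict]
          exact lintegral_prod_le _
      _ ≤ ∫⁻ τ in Ioo 0 s, ENNReal.ofReal c * A τ := by
          refine lintegral_mono_ae ?_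
          rw [ae_restrict_iff' measurableSet_Ioo]
          filter_upwards [hX2slice] with τ hτ hτI
          exact hτ hτI.1
      _ = ENNReal.ofReal c * ∫⁻ τ in Ioo 0 s, A τ := lintegral_const_mul _ hAm
  -- ### the pressure on `(0,s) × B_c`
  have hPbound : ∀ s : ℝ, 0 < s →
      ∫⁻ z in Ioo 0 s ×ˢ ball (0 : EuclideanSpace ℝ (Fin 3)) c, ‖π z.1 z.2‖ₑ ^ (3 / 2 : ℝ) ≤
        s2 * Cn * cm2 * (∫⁻ z in Ioo 0 s ×ˢ ball (0 : EuclideanSpace ℝ (Fin 3)) 1, ‖v z.1 z.2‖ₑ ^ (3 : ℝ)) +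
          Pfar * ∫⁻ σ in Ioo 0 s, (A σ + A σ ^ 3) := by
    intro s hs0
    have hdec0 : ∀ᵐ z ∂(volume.restrict (Ioo 0 s ×ˢ ball (0 : EuclideanSpace ℝ (Fin 3)) c)),
        π z.1 z.2 - (0 : ℝ → ℝ) z.1 =
          localPressureNear 0 c v z.1 z.2 + localPressureFar 0 c v z.1 z.2 :=
      (hdec s hs0).mono fun z hz => by rw [Pi.zero_apply, sub_zero]; exact hz
    have h := lintegral_gauged_pressure_le_of_farField hCn0 hnear hCK0 hCK hv hc0 (s := s)
      (g := (0 : ℝ → ℝ)) aestronglyMeasurable_const hdec0 hAm hfar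
    have hlhs : ∫⁻ z in Ioo 0 s ×ˢ ball (0 : EuclideanSpace ℝ (Fin 3)) c, ‖π z.1 z.2‖ₑ ^ (3 / 2 : ℝ) =
        ∫⁻ z in Ioo 0 s ×ˢ ball (0 : EuclideanSpace ℝ (Fin 3)) c,
          ‖π z.1 z.2 - (0 : ℝ → ℝ) z.1‖ₑ ^ (3 / 2 : ℝ) := by
      refine lintegral_congr fun z => ?_
      rw [Pi.zero_apply, sub_zero]
    -- the cubic integrand on `B_{2c} ⊆ B_{c^m}`, re-scaled to `B₁`
    have hG₃ : ∫⁻ z in Ioo 0 s ×ˢ ball (0 : EuclideanSpace ℝ (Fin 3)) (2 * c), ‖v z.1 z.2‖ₑ ^ (3 : ℝ) ≤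
        cm2 * ∫⁻ z in Ioo 0 s ×ˢ ball (0 : EuclideanSpace ℝ (Fin 3)) 1, ‖v z.1 z.2‖ₑ ^ (3 : ℝ) := by
      calc ∫⁻ z in Ioo 0 s ×ˢ ball (0 : EuclideanSpace ℝ (Fin 3)) (2 * c), ‖v z.1 z.2‖ₑ ^ (3 : ℝ)
          ≤ ∫⁻ z in Ioo 0 s ×ˢ ball (0 : EuclideanSpace ℝ (Fin 3)) (c ^ m), ‖v z.1 z.2‖ₑ ^ (3 : ℝ) :=
            lintegral_mono_set (Set.prod_mono le_rfl (ball_subset_ball hm))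
        _ ≤ cm2 * ∫⁻ z in Ioo 0 s ×ˢ ball (0 : EuclideanSpace ℝ (Fin 3)) 1, ‖v z.1 z.2‖ₑ ^ (3 : ℝ) :=
            setLIntegral_cylinder_enorm_cube_le_of_dss hcm1 (isDiscretelySelfSimilar_pow hdss m) hs0
    have h32 : ∫⁻ τ in Ioo 0 s, A τ ^ (3 / 2 : ℝ) ≤ ∫⁻ σ in Ioo 0 s, (A σ + A σ ^ 3) :=
      lintegral_mono fun σ => rpow_three_halves_le_self_add_pow_three _
    rw [hlhs]
    calc _ ≤ s2 * Cn * (∫⁻ z in Ioo 0 s ×ˢ ball (0 : EuclideanSpace ℝ (Fin 3)) (2 * c), ‖v z.1 z.2‖ₑ ^ (3 : ℝ)) +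
          s2 * VB * (cK * Kf) ^ (3 / 2 : ℝ) * ∫⁻ τ in Ioo 0 s, A τ ^ (3 / 2 : ℝ) := h
      _ ≤ s2 * Cn * (cm2 * ∫⁻ z in Ioo 0 s ×ˢ ball (0 : EuclideanSpace ℝ (Fin 3)) 1, ‖v z.1 z.2‖ₑ ^ (3 : ℝ)) +
          s2 * VB * (cK * Kf) ^ (3 / 2 : ℝ) * ∫⁻ σ in Ioo 0 s, (A σ + A σ ^ 3) := by
          gcongr
      _ = _ := by rw [hPfar]; ring
  refine ⟨G, hG, ?_, fun s hs0 hs1 => ?_⟩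
  · -- ### clause (i): the local energy inequality from `t = 0` and absorption
    have hLEI := hvT.ae_localEnergyIneq_initial_slice zero_le_one hm₀ hG1 hψs hψcs hψ0
    filter_upwards [hLEI, ae_restrict_mem measurableSet_Ioo] with s E hsI
    obtain ⟨hs0, hs1⟩ := hsI
    set Φ : ℝ≥0∞ := ∫⁻ σ in Ioo 0 s, (A σ + A σ ^ 3) with hΦ
    set D : ℝ≥0∞ := ∫⁻ z in Ioo 0 s ×ˢ (univ : Set (EuclideanSpace ℝ (Fin 3))),
      ENNReal.ofReal (frobeniusNormSq (G z.1 z.2)) * ENNReal.ofReal (χ z.2 ^ 2) with hD_def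
    set D₁ : ℝ≥0∞ := ∫⁻ z in Ioo 0 s ×ˢ ball (0 : EuclideanSpace ℝ (Fin 3)) 1,
      ENNReal.ofReal (frobeniusNormSq (G z.1 z.2)) with hD₁_def
    set 𝔄 : ℝ≥0∞ := ∫⁻ x, ‖v s x‖ₑ ^ 2 * ENNReal.ofReal (χ x ^ 2) with h𝔄
    set α₀ : ℝ≥0∞ := ∫⁻ x in ball (0 : EuclideanSpace ℝ (Fin 3)) c, ‖v₀ x‖ₑ ^ 2 with hα₀_def
    set X₃ : ℝ≥0∞ := ∫⁻ z in Ioo 0 s ×ˢ ball (0 : EuclideanSpace ℝ (Fin 3)) 1, ‖v z.1 z.2‖ₑ ^ (3 : ℝ)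
      with hX₃_def
    set X₃c : ℝ≥0∞ := ∫⁻ z in Ioo 0 s ×ˢ ball (0 : EuclideanSpace ℝ (Fin 3)) c, ‖v z.1 z.2‖ₑ ^ (3 : ℝ)
      with hX₃c_def
    set P : ℝ≥0∞ := ∫⁻ z in Ioo 0 s ×ˢ ball (0 : EuclideanSpace ℝ (Fin 3)) c, ‖π z.1 z.2‖ₑ ^ (3 / 2 : ℝ)
      with hP_def
    -- the dissipation with the weight is finite (local Leray class) and dominates `D₁`
    have hDle : D ≤ ∫⁻ z in Ioo 0 s ×ˢ ball (0 : EuclideanSpace ℝ (Fin 3)) c,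
        ENNReal.ofReal (frobeniusNormSq (G z.1 z.2)) := by
      refine setLIntegral_timeSlab_le_of_eq_zero_off measurableSet_Ioo measurableSet_ball
        (fun z _ => ?_) (fun z hz => ?_)
      · calc ENNReal.ofReal (frobeniusNormSq (G z.1 z.2)) * ENNReal.ofReal (χ z.2 ^ 2)
            ≤ ENNReal.ofReal (frobeniusNormSq (G z.1 z.2)) * 1 :=
              mul_le_mul' le_rfl (by rw [← ENNReal.ofReal_one]; exact ENNReal.ofReal_le_ofReal (hψ1 _))
          _ = _ := mul_one _
      · rw [hψc z.2 hz.2, ENNReal.ofReal_zero, mul_zero]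
    have hDt : D ≠ ⊤ := by
      refine ne_top_of_le_ne_top ENNReal.coe_ne_top (hDle.trans ((lintegral_mono_set ?_).trans (hCG 0)))
      refine Set.prod_mono (Ioo_subset_Ioo_right ?_) subset_rfl
      nlinarith
    have hD₁D : D₁ ≤ D := by
      calc D₁ = ∫⁻ z in Ioo 0 s ×ˢ ball (0 : EuclideanSpace ℝ (Fin 3)) 1,
            ENNReal.ofReal (frobeniusNormSq (G z.1 z.2)) * ENNReal.ofReal (χ z.2 ^ 2) :=
            setLIntegral_congr_fun (measurableSet_Ioo.prod measurableSet_ball) fun z hz => by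
              rw [hψB z.2 hz.2, ENNReal.ofReal_one, mul_one]
        _ ≤ D := lintegral_mono_set (prod_mono subset_rfl (subset_univ _))
    -- the datum term
    have hA₀ψ : ∫⁻ x, ‖v₀ x‖ₑ ^ 2 * ENNReal.ofReal (χ x ^ 2) ≤ α₀ := by
      calc ∫⁻ x, ‖v₀ x‖ₑ ^ 2 * ENNReal.ofReal (χ x ^ 2)
          ≤ ∫⁻ x, (ball (0 : EuclideanSpace ℝ (Fin 3)) c).indicator (fun x => ‖v₀ x‖ₑ ^ 2) x := by
            refine lintegral_mono fun x => ?_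
            by_cases hx : x ∈ ball (0 : EuclideanSpace ℝ (Fin 3)) c
            · rw [indicator_of_mem hx]
              calc ‖v₀ x‖ₑ ^ 2 * ENNReal.ofReal (χ x ^ 2) ≤ ‖v₀ x‖ₑ ^ 2 * 1 :=
                    mul_le_mul' le_rfl (by rw [← ENNReal.ofReal_one]; exact ENNReal.ofReal_le_ofReal (hψ1 x))
                _ = ‖v₀ x‖ₑ ^ 2 := mul_one _
            · rw [indicator_of_notMem hx, hψc x hx, ENNReal.ofReal_zero, mul_zero]
        _ = α₀ := lintegral_indicator measurableSet_ball _
    -- the flux in absolute value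
    set R₀ : ℝ × EuclideanSpace ℝ (Fin 3) → ℝ := fun z =>
      ‖v z.1 z.2‖ ^ 2 * (1 * Δ (fun x => χ x ^ 2) z.2) +
        (‖v z.1 z.2‖ ^ 2 + 2 * π z.1 z.2) * ⟪v z.1 z.2, gradient (fun x => χ x ^ 2) z.2⟫ with hR₀
    have hR₀int : IntegrableOn R₀ (Ioo 0 s ×ˢ (univ : Set (EuclideanSpace ℝ (Fin 3)))) volume :=
      (hvT.integrableOn_fluxRHS_slab hψs hψcs).mono_set
        (Set.prod_mono (Ioo_subset_Ioo_right hs1.le) subset_rfl)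
    set T₁ : ℝ × EuclideanSpace ℝ (Fin 3) → ℝ≥0∞ := fun z =>
      ‖v z.1 z.2‖ₑ ^ 2 * ‖(Δ (fun x => χ x ^ 2)) z.2‖ₑ with hT₁
    set T₂ : ℝ × EuclideanSpace ℝ (Fin 3) → ℝ≥0∞ := fun z =>
      ‖v z.1 z.2‖ₑ ^ 2 * ‖v z.1 z.2‖ₑ * ‖gradient (fun x => χ x ^ 2) z.2‖ₑ with hT₂
    set T₃ : ℝ × EuclideanSpace ℝ (Fin 3) → ℝ≥0∞ := fun z =>
      2 * ‖π z.1 z.2‖ₑ * ‖v z.1 z.2‖ₑ * ‖gradient (fun x => χ x ^ 2) z.2‖ₑ with hT₃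
    set R₁ : ℝ≥0∞ := ∫⁻ z in Ioo 0 s ×ˢ (univ : Set (EuclideanSpace ℝ (Fin 3))), T₁ z with hR₁
    set R₂ : ℝ≥0∞ := ∫⁻ z in Ioo 0 s ×ˢ (univ : Set (EuclideanSpace ℝ (Fin 3))), T₂ z with hR₂
    set R₃ : ℝ≥0∞ := ∫⁻ z in Ioo 0 s ×ˢ (univ : Set (EuclideanSpace ℝ (Fin 3))), T₃ z with hR₃
    have mv := mvB s (univ : Set (EuclideanSpace ℝ (Fin 3)))
    have m1 : AEMeasurable T₁ (volume.restrict (Ioo (0 : ℝ) s ×ˢ (univ : Set (EuclideanSpace ℝ (Fin 3))))) :=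
      (mv.enorm.pow_const 2).mul (hΔc.comp continuous_snd).aestronglyMeasurable.enorm
    have m2 : AEMeasurable T₂ (volume.restrict (Ioo (0 : ℝ) s ×ˢ (univ : Set (EuclideanSpace ℝ (Fin 3))))) :=
      ((mv.enorm.pow_const 2).mul mv.enorm).mul (hgc.comp continuous_snd).aestronglyMeasurable.enorm
    have hflux : ENNReal.ofReal (∫ z in Ioo 0 s ×ˢ (univ : Set (EuclideanSpace ℝ (Fin 3))), R₀ z) ≤
        R₁ + R₂ + R₃ := by
      calc ENNReal.ofReal (∫ z in Ioo 0 s ×ˢ (univ : Set (EuclideanSpace ℝ (Fin 3))), R₀ z)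
          ≤ ENNReal.ofReal (∫ z in Ioo 0 s ×ˢ (univ : Set (EuclideanSpace ℝ (Fin 3))), ‖R₀ z‖) :=
            ENNReal.ofReal_le_ofReal ((le_abs_self _).trans (by
              rw [← Real.norm_eq_abs]; exact norm_integral_le_integral_norm _))
        _ = ∫⁻ z in Ioo 0 s ×ˢ (univ : Set (EuclideanSpace ℝ (Fin 3))), ‖R₀ z‖ₑ :=
            ofReal_integral_norm_eq_lintegral_enorm hR₀int
        _ ≤ ∫⁻ z in Ioo 0 s ×ˢ (univ : Set (EuclideanSpace ℝ (Fin 3))), (T₁ z + T₂ z + T₃ z) := by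
            refine lintegral_mono fun z => ?_
            have h := enorm_lei_flux_le (v z.1 z.2) (gradient (fun x => χ x ^ 2) z.2) 1
              ((Δ (fun x => χ x ^ 2)) z.2) (π z.1 z.2)
            calc ‖R₀ z‖ₑ = ‖‖v z.1 z.2‖ ^ 2 * (1 * (Δ (fun x => χ x ^ 2)) z.2) +
                  (‖v z.1 z.2‖ ^ 2 + 2 * π z.1 z.2) * ⟪v z.1 z.2, gradient (fun x => χ x ^ 2) z.2⟫‖ₑ := rfl
              _ ≤ ‖(1 : ℝ)‖ₑ * (‖v z.1 z.2‖ₑ ^ 2 * ‖(Δ (fun x => χ x ^ 2)) z.2‖ₑ) + T₂ z + T₃ z := h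
              _ = T₁ z + T₂ z + T₃ z := by rw [enorm_one, one_mul]
        _ = R₁ + R₂ + R₃ := by
            have m12 : AEMeasurable (fun z : ℝ × EuclideanSpace ℝ (Fin 3) => T₁ z + T₂ z)
                (volume.restrict (Ioo (0 : ℝ) s ×ˢ (univ : Set (EuclideanSpace ℝ (Fin 3))))) := m1.add m2
            rw [hR₁, hR₂, hR₃, ← lintegral_add_left' m1, ← lintegral_add_left' m12]
    -- `R₁ ≤ K₁ Φ` by (3.6)
    have hR₁le : R₁ ≤ K₁ * Φ := by
      have h1 : R₁ ≤ ∫⁻ z in Ioo 0 s ×ˢ ball (0 : EuclideanSpace ℝ (Fin 3)) c,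
          ENNReal.ofReal MΔ * ‖v z.1 z.2‖ₑ ^ 2 := by
        refine setLIntegral_timeSlab_le_of_eq_zero_off measurableSet_Ioo measurableSet_ball
          (fun z _ => ?_) (fun z hz => ?_)
        · exact (mul_le_mul' le_rfl (eΔ _)).trans_eq (mul_comm _ _)
        · show ‖v z.1 z.2‖ₑ ^ 2 * ‖(Δ (fun x => χ x ^ 2)) z.2‖ₑ = 0
          rw [hΔ0 z.2 hz.2, enorm_zero, mul_zero]
      have hAΦ : ∫⁻ τ in Ioo 0 s, A τ ≤ Φ := lintegral_mono fun σ => le_self_add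
      calc R₁ ≤ ∫⁻ z in Ioo 0 s ×ˢ ball (0 : EuclideanSpace ℝ (Fin 3)) c,
            ENNReal.ofReal MΔ * ‖v z.1 z.2‖ₑ ^ 2 := h1
        _ = ENNReal.ofReal MΔ * ∫⁻ z in Ioo 0 s ×ˢ ball (0 : EuclideanSpace ℝ (Fin 3)) c,
            ‖v z.1 z.2‖ₑ ^ 2 := lintegral_const_mul' _ _ ENNReal.ofReal_ne_top
        _ ≤ ENNReal.ofReal MΔ * (ENNReal.ofReal c * Φ) :=
            mul_le_mul' le_rfl ((hX2 s).trans (mul_le_mul' le_rfl hAΦ))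
        _ = K₁ * Φ := by rw [hK₁, mul_assoc]
    -- the cubic term on `B₁` (Gagliardo–Nirenberg) and on `B_c` ((3.6))
    have hX₃ : X₃ ≤ Cc * gi * Φ + Cc * γ * D := by
      have h := hcube s hs1.le γ hγ0 hγt
      have hint : ∫⁻ σ in Ioo 0 s, (A σ + (1 + (γ⁻¹) ^ 3) * A σ ^ 3) ≤ gi * Φ := by
        calc ∫⁻ σ in Ioo 0 s, (A σ + (1 + (γ⁻¹) ^ 3) * A σ ^ 3)
            ≤ ∫⁻ σ in Ioo 0 s, gi * (A σ + A σ ^ 3) := by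
              refine lintegral_mono fun σ => ?_
              rw [mul_add]
              exact add_le_add (le_mul_of_one_le_left' h1gi) le_rfl
          _ = gi * Φ := lintegral_const_mul _ (hAm.add (hAm.pow_const 3))
      calc X₃ ≤ Cc * (∫⁻ σ in Ioo 0 s, (A σ + (1 + (γ⁻¹) ^ 3) * A σ ^ 3)) + Cc * γ * D₁ := h
        _ ≤ Cc * (gi * Φ) + Cc * γ * D := add_le_add (mul_le_mul' le_rfl hint) (mul_le_mul' le_rfl hD₁D)
        _ = Cc * gi * Φ + Cc * γ * D := by ring
    have hX₃c : X₃c ≤ c2 * (Cc * gi * Φ + Cc * γ * D) :=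
      (setLIntegral_cylinder_enorm_cube_le_of_dss hc hdss hs0).trans (mul_le_mul' le_rfl hX₃)
    -- `R₂ ≤ K₂ X₃c`
    have hR₂le : R₂ ≤ K₂ * (c2 * (Cc * gi * Φ + Cc * γ * D)) := by
      have h1 : R₂ ≤ ∫⁻ z in Ioo 0 s ×ˢ ball (0 : EuclideanSpace ℝ (Fin 3)) c,
          ENNReal.ofReal Mg * ‖v z.1 z.2‖ₑ ^ (3 : ℝ) := by
        refine setLIntegral_timeSlab_le_of_eq_zero_off measurableSet_Ioo measurableSet_ball
          (fun z _ => ?_) (fun z hz => ?_)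
        · show ‖v z.1 z.2‖ₑ ^ 2 * ‖v z.1 z.2‖ₑ * ‖gradient (fun x => χ x ^ 2) z.2‖ₑ ≤ _
          have e3 : ‖v z.1 z.2‖ₑ ^ 2 * ‖v z.1 z.2‖ₑ = ‖v z.1 z.2‖ₑ ^ (3 : ℝ) := by
            rw [← pow_succ, show (3 : ℝ) = ((3 : ℕ) : ℝ) by norm_num, ENNReal.rpow_natCast]
          rw [e3, mul_comm (ENNReal.ofReal Mg)]
          exact mul_le_mul' le_rfl (eg _)
        · show ‖v z.1 z.2‖ₑ ^ 2 * ‖v z.1 z.2‖ₑ * ‖gradient (fun x => χ x ^ 2) z.2‖ₑ = 0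
          rw [hg0 z.2 hz.2, enorm_zero, mul_zero]
      calc R₂ ≤ _ := h1
        _ = ENNReal.ofReal Mg * X₃c := lintegral_const_mul' _ _ ENNReal.ofReal_ne_top
        _ ≤ K₂ * (c2 * (Cc * gi * Φ + Cc * γ * D)) := mul_le_mul' le_rfl hX₃c
    -- `R₃ ≤ K₃ (P + X₃c)` by Young, and the pressure bound
    have hR₃le : R₃ ≤ K₃ * ((s2 * Cn * cm2 * (Cc * gi * Φ + Cc * γ * D) + Pfar * Φ) +
        c2 * (Cc * gi * Φ + Cc * γ * D)) := by
      have h1 : R₃ ≤ ∫⁻ z in Ioo 0 s ×ˢ ball (0 : EuclideanSpace ℝ (Fin 3)) c,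
          K₃ * (‖π z.1 z.2‖ₑ * ‖v z.1 z.2‖ₑ) := by
        refine setLIntegral_timeSlab_le_of_eq_zero_off measurableSet_Ioo measurableSet_ball
          (fun z _ => ?_) (fun z hz => ?_)
        · show 2 * ‖π z.1 z.2‖ₑ * ‖v z.1 z.2‖ₑ * ‖gradient (fun x => χ x ^ 2) z.2‖ₑ ≤ _
          rw [hK₃]
          calc 2 * ‖π z.1 z.2‖ₑ * ‖v z.1 z.2‖ₑ * ‖gradient (fun x => χ x ^ 2) z.2‖ₑ
              ≤ 2 * ‖π z.1 z.2‖ₑ * ‖v z.1 z.2‖ₑ * ENNReal.ofReal Mg := mul_le_mul' le_rfl (eg _)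
            _ = 2 * ENNReal.ofReal Mg * (‖π z.1 z.2‖ₑ * ‖v z.1 z.2‖ₑ) := by ring
        · show 2 * ‖π z.1 z.2‖ₑ * ‖v z.1 z.2‖ₑ * ‖gradient (fun x => χ x ^ 2) z.2‖ₑ = 0
          rw [hg0 z.2 hz.2, enorm_zero, mul_zero]
      have mv3 : AEMeasurable (fun z : ℝ × EuclideanSpace ℝ (Fin 3) => ‖v z.1 z.2‖ₑ ^ (3 : ℝ))
          (volume.restrict (Ioo (0 : ℝ) s ×ˢ ball (0 : EuclideanSpace ℝ (Fin 3)) c)) :=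
        (mvB s _).enorm.pow_const _
      have h2 : ∫⁻ z in Ioo 0 s ×ˢ ball (0 : EuclideanSpace ℝ (Fin 3)) c, ‖π z.1 z.2‖ₑ * ‖v z.1 z.2‖ₑ ≤
          P + X₃c := by
        rw [hP_def, hX₃c_def, ← lintegral_add_right' _ mv3]
        exact lintegral_mono fun z => mul_le_rpow_threeHalves_add_rpow_three _ _
      have hP : P ≤ s2 * Cn * cm2 * (Cc * gi * Φ + Cc * γ * D) + Pfar * Φ :=
        (hPbound s hs0).trans (add_le_add (mul_le_mul' le_rfl hX₃) le_rfl)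
      calc R₃ ≤ _ := h1
        _ = K₃ * ∫⁻ z in Ioo 0 s ×ˢ ball (0 : EuclideanSpace ℝ (Fin 3)) c,
            ‖π z.1 z.2‖ₑ * ‖v z.1 z.2‖ₑ := lintegral_const_mul' _ _ hK₃t
        _ ≤ K₃ * ((s2 * Cn * cm2 * (Cc * gi * Φ + Cc * γ * D) + Pfar * Φ) +
            c2 * (Cc * gi * Φ + Cc * γ * D)) :=
            mul_le_mul' le_rfl (h2.trans (add_le_add hP hX₃c))
    -- collect: the right-hand side is at most `α₀ + C'Φ + SγD ≤ α₀ + C'Φ + D`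
    have hsum : R₁ + R₂ + R₃ ≤ C' * Φ + S * γ * D := by
      calc R₁ + R₂ + R₃ ≤ K₁ * Φ + K₂ * (c2 * (Cc * gi * Φ + Cc * γ * D)) +
            K₃ * ((s2 * Cn * cm2 * (Cc * gi * Φ + Cc * γ * D) + Pfar * Φ) +
              c2 * (Cc * gi * Φ + Cc * γ * D)) :=
            add_le_add (add_le_add hR₁le hR₂le) hR₃le
        _ = C' * Φ + S * γ * D := by rw [hC', hS]; ring
    have hE' : 𝔄 + 2 * D ≤ α₀ + C' * Φ + D := by
      have h2 : ENNReal.ofReal (2 * 1) = 2 := by norm_num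
      calc 𝔄 + 2 * D = 𝔄 + ENNReal.ofReal (2 * 1) * D := by rw [h2]
        _ ≤ (∫⁻ x, ‖v₀ x‖ₑ ^ 2 * ENNReal.ofReal (χ x ^ 2)) +
            ENNReal.ofReal (∫ z in Ioo 0 s ×ˢ (univ : Set (EuclideanSpace ℝ (Fin 3))), R₀ z) := E
        _ ≤ α₀ + (R₁ + R₂ + R₃) := add_le_add hA₀ψ hflux
        _ ≤ α₀ + (C' * Φ + S * γ * D) := add_le_add le_rfl hsum
        _ ≤ α₀ + (C' * Φ + 1 * D) := by gcongr
        _ = α₀ + C' * Φ + D := by rw [one_mul, add_assoc]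
    have habs : 𝔄 + D ≤ α₀ + C' * Φ := add_le_of_add_two_mul_le' hDt hE'
    have hball : ballEnergy v s ≤ 𝔄 := by
      calc ballEnergy v s = ∫⁻ x in ball (0 : EuclideanSpace ℝ (Fin 3)) 1,
            ‖v s x‖ₑ ^ 2 * ENNReal.ofReal (χ x ^ 2) :=
            setLIntegral_congr_fun measurableSet_ball fun x hx => by
              rw [hψB x hx, ENNReal.ofReal_one, mul_one]
        _ ≤ 𝔄 := setLIntegral_le_lintegral _ _
    exact (add_le_add hball hD₁D).trans habs
  · -- ### clause (ii): the pressure on the unit cylinder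
    set Φ : ℝ≥0∞ := ∫⁻ σ in Ioo 0 s, (A σ + A σ ^ 3) with hΦ
    set D₁ : ℝ≥0∞ := ∫⁻ z in Ioo 0 s ×ˢ ball (0 : EuclideanSpace ℝ (Fin 3)) 1,
      ENNReal.ofReal (frobeniusNormSq (G z.1 z.2)) with hD₁_def
    set X₃ : ℝ≥0∞ := ∫⁻ z in Ioo 0 s ×ˢ ball (0 : EuclideanSpace ℝ (Fin 3)) 1, ‖v z.1 z.2‖ₑ ^ (3 : ℝ)
      with hX₃_def
    have hX₃ : X₃ ≤ Cc * (2 * Φ) + Cc * D₁ := by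
      have h := hcube s hs1 1 one_ne_zero ENNReal.one_ne_top
      rw [inv_one, one_pow, mul_one] at h
      have hint : ∫⁻ σ in Ioo 0 s, (A σ + (1 + 1) * A σ ^ 3) ≤ 2 * Φ := by
        calc ∫⁻ σ in Ioo 0 s, (A σ + (1 + 1) * A σ ^ 3) ≤ ∫⁻ σ in Ioo 0 s, 2 * (A σ + A σ ^ 3) := by
              refine lintegral_mono fun σ => ?_
              rw [mul_add, one_add_one_eq_two]
              exact add_le_add (le_mul_of_one_le_left' one_le_two) le_rfl
          _ = 2 * Φ := lintegral_const_mul _ (hAm.add (hAm.pow_const 3))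
      exact h.trans (add_le_add (mul_le_mul' le_rfl hint) le_rfl)
    calc ∫⁻ z in Ioo 0 s ×ˢ ball (0 : EuclideanSpace ℝ (Fin 3)) 1, ‖π z.1 z.2‖ₑ ^ (3 / 2 : ℝ)
        ≤ ∫⁻ z in Ioo 0 s ×ˢ ball (0 : EuclideanSpace ℝ (Fin 3)) c, ‖π z.1 z.2‖ₑ ^ (3 / 2 : ℝ) :=
          lintegral_mono_set (prod_mono subset_rfl (ball_subset_ball hc.le))
      _ ≤ s2 * Cn * cm2 * X₃ + Pfar * Φ := hPbound s hs0
      _ ≤ s2 * Cn * cm2 * (Cc * (2 * Φ) + Cc * D₁) + Pfar * Φ := by gcongr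
      _ = (s2 * Cn * cm2 * (2 * Cc) + Pfar) * Φ + s2 * Cn * cm2 * Cc * D₁ := by ring
      _ ≤ Cp * Φ + Cp * D₁ := by
          refine add_le_add (by rw [hCp]) (mul_le_mul' ?_ le_rfl)
          rw [hCp]
          calc s2 * Cn * cm2 * Cc ≤ s2 * Cn * cm2 * (2 * Cc) :=
                mul_le_mul' le_rfl (le_mul_of_one_le_left' one_le_two)
            _ ≤ s2 * Cn * cm2 * (2 * Cc) + Pfar := le_self_add
      _ = Cp * (Φ + D₁) := (mul_add _ _ _).symm

/-! ## The bootstrap: Prop. 3.1 of Bradshaw–Tsai 2019 for every DSS local Leray solution -/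

/-- **The running majorant lies below a continuous envelope.** If `α ≤ F` a.e. on `(0,1)`, `F` is
monotone on `[0,1]` and continuous, then the majorant `A` of `exists_runningMajorant` satisfies
`A s ≤ F s` for `s < 1`. [folklore] -/
theorem runningMajorant_le_of_continuous {α A F : ℝ → ℝ≥0∞}
    (hAle : ∀ (t q : ℝ), t < q → ∀ b : ℝ≥0∞,
      (∀ᵐ s ∂(volume.restrict (Ioo 0 q)), α s ≤ b) → A t ≤ b)
    (hαF : ∀ᵐ s ∂(volume.restrict (Ioo (0 : ℝ) 1)), α s ≤ F s)
    (hFmono : MonotoneOn F (Icc 0 1)) (hFc : Continuous F) {s : ℝ} (hs0 : 0 ≤ s) (hs1 : s < 1) :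
    A s ≤ F s := by
  have hq : ∀ q ∈ Ioo s 1, A s ≤ F q := by
    intro q hq
    refine hAle s q hq.1 (F q) ?_
    have h1 : ∀ᵐ σ ∂(volume.restrict (Ioo (0 : ℝ) q)), α σ ≤ F σ :=
      ae_restrict_of_ae_restrict_of_subset (Ioo_subset_Ioo_right hq.2.le) hαF
    filter_upwards [h1, ae_restrict_mem measurableSet_Ioo] with σ hσ hσI
    exact hσ.trans (hFmono ⟨hσI.1.le, (hσI.2.trans hq.2).le⟩ ⟨hs0.trans hq.1.le, hq.2.le⟩ hσI.2.le)
  have ht : Tendsto F (𝓝[>] s) (𝓝 (F s)) := (hFc.tendsto s).mono_left nhdsWithin_le_nhds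
  refine ge_of_tendsto ht ?_
  filter_upwards [self_mem_nhdsWithin, eventually_nhdsWithin_of_eventually_nhds (eventually_lt_nhds hs1)]
    with q hqs hq1
  exact hq q ⟨hqs, hq1⟩

/-- **Bradshaw–Tsai 2019, Proposition 3.1, for every `λ`-DSS local Leray solution** (the printed
statement concerns "a `λ`-DSS local Leray solution evolving from `v₀` constructed in [BT1]"; the
bound holds for the whole class): fix `λ = c > 1` and `M`. There are `T = T(λ, M) > 0` and
`C = C(λ, M)` such that every local Leray solution `(v, π)` (viscosity `1`, measurable datum `v₀`
with `‖v₀‖²_{L²(B_λ)} ≤ M`) with `v` `λ`-DSS admits a pressure `π'` (the gauged pressure of the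
local expansion at the origin, `(v, π')` again a local Leray solution) with
`esssup_{0<t<T} ∫_{B₁}|v|² ≤ C`, `∫₀ᵀ∫_{B₁}|∇v|² ≤ C`, `∫₀ᵀ∫_{B₁}|π'|^{3/2} ≤ C`. Proof: the energy
envelope `F(t) = α₀ + C₀∫₀ᵗ(A + A³)` of `exists_energy_envelope` (with `A` the running essential
supremum of `α = ∫_{B₁}|v|²`, `exists_runningMajorant`) is continuous and dominates `A` on `[0,1)`;
the continuity argument (3.13) ⇒ (3.14) (`continuity_argument`) applied to `F` gives `F ≤ 2a` on
`(0, T]`, `a = M + 1`, `T = (1 + 2C₀(2 + 8a²))⁻¹` — this replaces the continuity in time of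
`∫_{B₁}|v_ε(t)|²` for the mollified approximants used in print ("This is not clearly true for
`∫_{B₁}|v(x,t)|² dx`", p. 8). [cite: BradshawTsai2019, Prop 3.1 (proof pp. 8–10, (3.12)–(3.14))] -/
theorem dss_localLeray_apriori {c : ℝ} (hc : 1 < c) (M : ℝ≥0) :
    ∃ T : ℝ, 0 < T ∧ ∃ C : ℝ≥0,
      ∀ (v₀ : EuclideanSpace ℝ (Fin 3) → EuclideanSpace ℝ (Fin 3))
        (v : ℝ → EuclideanSpace ℝ (Fin 3) → EuclideanSpace ℝ (Fin 3))
        (π : ℝ → EuclideanSpace ℝ (Fin 3) → ℝ),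
        AEStronglyMeasurable v₀ volume → IsLocalLeraySolution 1 v₀ v π →
        IsDiscretelySelfSimilar c v →
        ∫⁻ x in ball (0 : EuclideanSpace ℝ (Fin 3)) c, ‖v₀ x‖ₑ ^ 2 ≤ M →
        ∃ π' : ℝ → EuclideanSpace ℝ (Fin 3) → ℝ, IsLocalLeraySolution 1 v₀ v π' ∧
          (∀ᵐ t ∂(volume.restrict (Ioo 0 T)),
            ∫⁻ x in ball (0 : EuclideanSpace ℝ (Fin 3)) 1, ‖v t x‖ₑ ^ 2 ≤ C) ∧
          (∃ G : ℝ → EuclideanSpace ℝ (Fin 3) → EuclideanSpace ℝ (Fin 3) →L[ℝ] EuclideanSpace ℝ (Fin 3),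
            HasWeakSpatialGradientOn (slab (EuclideanSpace ℝ (Fin 3)) (Ioi 0) isOpen_Ioi) v G ∧
            ∫⁻ z in Ioo 0 T ×ˢ ball (0 : EuclideanSpace ℝ (Fin 3)) 1,
              ENNReal.ofReal (frobeniusNormSq (G z.1 z.2)) ≤ C) ∧
          ∫⁻ z in Ioo 0 T ×ˢ ball (0 : EuclideanSpace ℝ (Fin 3)) 1, ‖π' z.1 z.2‖ₑ ^ (3 / 2 : ℝ) ≤ C := by
  have hc0 : 0 < c := zero_lt_one.trans hc
  obtain ⟨C₀, hC₀t, Cp, hCpt, henv⟩ := exists_energy_envelope hc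
  -- ### the constants `a`, `T`
  set C₀n : ℝ≥0 := C₀.toNNReal with hC₀n
  have hC₀e : C₀ = (C₀n : ℝ≥0∞) := (ENNReal.coe_toNNReal hC₀t).symm
  set a : ℝ≥0 := M + 1 with ha_def
  have ha0 : a ≠ 0 := by rw [ha_def]; exact (lt_of_lt_of_le one_pos le_add_self).ne'
  set D : ℝ≥0 := 1 + 2 * (C₀n * (2 + 8 * a ^ 2)) with hD_def
  have hD1 : 1 ≤ D := by rw [hD_def]; exact le_self_add
  have hD0 : 0 < D := one_pos.trans_le hD1
  set Tn : ℝ≥0 := D⁻¹ with hTn_def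
  have hTn0 : 0 < Tn := inv_pos.2 hD0
  have hTn1 : Tn ≤ 1 := inv_le_one_of_one_le₀ hD1
  have hsmallN : C₀n * Tn * (2 + 8 * a ^ 2) < 1 := by
    rw [← NNReal.coe_lt_coe, hTn_def, hD_def]
    push_cast
    rw [mul_right_comm, ← div_eq_mul_inv, div_lt_one (by positivity)]
    nlinarith [mul_nonneg (NNReal.coe_nonneg C₀n) (by positivity : (0 : ℝ) ≤ 2 + 8 * (a : ℝ) ^ 2)]
  set T : ℝ := (Tn : ℝ) with hT_def
  have hT0 : 0 < T := NNReal.coe_pos.2 hTn0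
  have hT1 : T ≤ 1 := by rw [hT_def, ← NNReal.coe_one]; exact NNReal.coe_le_coe.2 hTn1
  have hTE : ENNReal.ofReal T = (Tn : ℝ≥0∞) := ENNReal.ofReal_coe_nnreal
  have hsmall : (C₀n : ℝ≥0∞) * ENNReal.ofReal T * (2 + 8 * (a : ℝ≥0∞) ^ 2) < 1 := by
    rw [hTE]
    have h1 := ENNReal.coe_lt_coe.2 hsmallN
    push_cast at h1
    exact h1
  -- ### the final bound
  set I : ℝ≥0∞ := (2 * (a : ℝ≥0∞) + (2 * (a : ℝ≥0∞)) ^ 3) * (Tn : ℝ≥0∞) with hI_def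
  set B : ℝ≥0∞ := 2 * (a : ℝ≥0∞) + Cp * (I + 2 * (a : ℝ≥0∞)) with hB_def
  have h2atop : 2 * (a : ℝ≥0∞) ≠ ⊤ := ENNReal.mul_ne_top ENNReal.ofNat_ne_top ENNReal.coe_ne_top
  have hItop : I ≠ ⊤ := ENNReal.mul_ne_top
    (ENNReal.add_ne_top.2 ⟨h2atop, ENNReal.pow_ne_top h2atop⟩) ENNReal.coe_ne_top
  have hBtop : B ≠ ⊤ := ENNReal.add_ne_top.2 ⟨h2atop,
    ENNReal.mul_ne_top hCpt (ENNReal.add_ne_top.2 ⟨hItop, h2atop⟩)⟩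
  have hB1 : 2 * (a : ℝ≥0∞) ≤ B := le_self_add
  have hB2 : Cp * (I + 2 * (a : ℝ≥0∞)) ≤ B := le_add_self
  refine ⟨T, hT0, B.toNNReal, ?_⟩
  intro v₀ v π hm₀ hv hdss hM
  rw [ENNReal.coe_toNNReal hBtop]
  -- ### gauge, majorant, envelope
  obtain ⟨π', hv', hdec⟩ := exists_originGaugedPressure hv hc0
  obtain ⟨A, hA, hαA, hAle⟩ := exists_runningMajorant (ballEnergy v)
  obtain ⟨G, hG, hEn, hPr⟩ := henv v₀ v π' A hm₀ hv' hdss hdec hA hαA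
  set α₀ : ℝ≥0∞ := ∫⁻ x in ball (0 : EuclideanSpace ℝ (Fin 3)) c, ‖v₀ x‖ₑ ^ 2 with hα₀
  have hMa : ((M : ℝ≥0) : ℝ≥0∞) ≤ (a : ℝ≥0∞) := by rw [ha_def]; push_cast; exact le_self_add
  have hα₀a : α₀ ≤ (a : ℝ≥0∞) := hM.trans hMa
  -- ### `A` is bounded on `(0,1)`
  obtain ⟨C₁, hC₁⟩ := hv.uniformLocalEnergy 1 one_pos
  have hA1 : ∀ t : ℝ, t < 1 → A t ≤ C₁ := by
    intro t ht
    refine hAle t 1 ht C₁ ?_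
    have h : ∀ᵐ s ∂(volume.restrict (Ioo (0 : ℝ) (1 ^ 2))), ∀ x₀ : EuclideanSpace ℝ (Fin 3),
        ∫⁻ x in ball x₀ 1, ‖v s x‖ₑ ^ 2 ≤ C₁ := hC₁
    rw [one_pow] at h
    exact h.mono fun s hs => hs 0
  -- ### the integrand `A + A³` and its primitive
  set f : ℝ → ℝ≥0∞ := fun σ => A σ + A σ ^ 3 with hf
  have hAm : Measurable A := hA.measurable
  have hfm : Measurable f := hAm.add (hAm.pow_const 3)
  set K : ℝ≥0∞ := (C₁ : ℝ≥0∞) + (C₁ : ℝ≥0∞) ^ 3 with hK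
  have hKt : K ≠ ⊤ := ENNReal.add_ne_top.2 ⟨ENNReal.coe_ne_top, ENNReal.pow_ne_top ENNReal.coe_ne_top⟩
  have hfK : ∀ σ ∈ Ioo (0 : ℝ) 1, f σ ≤ K := fun σ hσ =>
    add_le_add (hA1 σ hσ.2) (pow_le_pow_left' (hA1 σ hσ.2) 3)
  set fr : ℝ → ℝ := (Ioo (0 : ℝ) 1).indicator fun σ => (f σ).toReal with hfr
  have hfrm : Measurable fr := hfm.ennreal_toReal.indicator measurableSet_Ioo
  have hfr0 : ∀ σ, 0 ≤ fr σ := fun σ => by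
    rw [hfr]; exact indicator_nonneg (fun _ _ => ENNReal.toReal_nonneg) _
  have hfrK : ∀ σ, fr σ ≤ K.toReal := fun σ => by
    rw [hfr]
    by_cases hσ : σ ∈ Ioo (0 : ℝ) 1
    · rw [indicator_of_mem hσ]; exact ENNReal.toReal_mono hKt (hfK σ hσ)
    · rw [indicator_of_notMem hσ]; exact ENNReal.toReal_nonneg
  have hIO : ∀ S : Set ℝ, volume S < ⊤ → IntegrableOn fr S volume := fun S hS =>
    IntegrableOn.of_bound hS hfrm.aestronglyMeasurable K.toReal (ae_of_all _ fun σ => by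
      rw [Real.norm_eq_abs, abs_of_nonneg (hfr0 σ)]; exact hfrK σ)
  have hfrint : ∀ a b : ℝ, IntervalIntegrable fr volume a b := fun a b =>
    ⟨hIO _ measure_Ioc_lt_top, hIO _ measure_Ioc_lt_top⟩
  set g : ℝ → ℝ := fun t => ∫ σ in (0 : ℝ)..t, fr σ with hg
  have hgc : Continuous g := intervalIntegral.continuous_primitive hfrint 0
  have hgf : ∀ t ∈ Icc (0 : ℝ) 1, ENNReal.ofReal (g t) = ∫⁻ σ in Ioo 0 t, f σ := by
    intro t ht
    rw [hg]
    dsimp only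
    rw [intervalIntegral.integral_of_le ht.1, integral_Ioc_eq_integral_Ioo,
      ofReal_integral_eq_lintegral_ofReal (hIO _ measure_Ioo_lt_top) (ae_of_all _ hfr0)]
    refine setLIntegral_congr_fun measurableSet_Ioo fun σ hσ => ?_
    have hσ1 : σ ∈ Ioo (0 : ℝ) 1 := ⟨hσ.1, hσ.2.trans_le ht.2⟩
    rw [hfr, indicator_of_mem hσ1, ENNReal.ofReal_toReal (ne_top_of_le_ne_top hKt (hfK σ hσ1))]
  -- ### the continuous envelope `F`
  set F : ℝ → ℝ≥0∞ := fun t => α₀ + C₀ * ENNReal.ofReal (g (min t 1)) with hF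
  have hFc : Continuous F := by
    have h1 : Continuous fun t => ENNReal.ofReal (g (min t 1)) :=
      ENNReal.continuous_ofReal.comp (hgc.comp (continuous_id.min continuous_const))
    exact continuous_const.add ((ENNReal.continuous_const_mul hC₀t).comp h1)
  have hFt : ∀ t ∈ Icc (0 : ℝ) 1, F t = α₀ + C₀ * ∫⁻ σ in Ioo 0 t, f σ := fun t ht => by
    rw [hF]
    dsimp only
    rw [min_eq_left ht.2, hgf t ht]
  have hF0 : F 0 = α₀ := by
    rw [hFt 0 ⟨le_rfl, zero_le_one⟩, Ioo_self, Measure.restrict_empty, lintegral_zero_measure,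
      mul_zero, add_zero]
  have hFmono : MonotoneOn F (Icc 0 1) := fun t ht t' ht' htt' => by
    rw [hFt t ht, hFt t' ht']
    exact add_le_add le_rfl (mul_le_mul' le_rfl (lintegral_mono_set (Ioo_subset_Ioo_right htt')))
  -- `α ≤ F` a.e. on `(0,1)` (clause (i)), hence `A ≤ F` on `[0,1)`
  have hαF : ∀ᵐ s ∂(volume.restrict (Ioo (0 : ℝ) 1)), ballEnergy v s ≤ F s := by
    filter_upwards [hEn, ae_restrict_mem measurableSet_Ioo] with s hs hsI
    rw [hFt s ⟨hsI.1.le, hsI.2.le⟩]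
    exact le_trans le_self_add hs
  have hAF : ∀ s : ℝ, 0 ≤ s → s < 1 → A s ≤ F s := fun s hs0 hs1 =>
    runningMajorant_le_of_continuous hAle hαF hFmono hFc hs0 hs1
  -- ### the continuity argument for `F`
  have hboot : ∀ t ∈ Ioc 0 T, F t ≤ 2 * (a : ℝ≥0∞) := by
    refine continuity_argument (C₀ := C₀) hT1 hα₀a (ENNReal.coe_ne_zero.2 ha0) ENNReal.coe_ne_top ?_
      hFc.continuousOn le_rfl ?_ ?_
    · rw [hC₀e]; exact hsmall
    · rw [← hF0]; exact (hFc.tendsto 0).mono_left nhdsWithin_le_nhds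
    · intro t ht
      rw [hFt t ⟨ht.1.le, ht.2⟩]
      refine add_le_add le_rfl (mul_le_mul' le_rfl (setLIntegral_mono' measurableSet_Ioo fun σ hσ => ?_))
      have hσ1 : σ < 1 := hσ.2.trans_le ht.2
      have h1 : A σ ≤ ⨆ τ ∈ Ioc (0 : ℝ) σ, F τ :=
        (hAF σ hσ.1.le hσ1).trans (le_iSup₂ (f := fun τ (_ : τ ∈ Ioc (0 : ℝ) σ) => F τ) σ ⟨hσ.1, le_rfl⟩)
      rw [hf]
      dsimp only
      rw [add_comm]
      exact add_le_add (pow_le_pow_left' h1 3) h1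
  -- ### consequences on `(0, T)`
  set DT : ℝ → ℝ≥0∞ := fun t => ∫⁻ z in Ioo 0 t ×ˢ ball (0 : EuclideanSpace ℝ (Fin 3)) 1,
    ENNReal.ofReal (frobeniusNormSq (G z.1 z.2)) with hDT
  have hgood : ∀ᵐ t ∂(volume.restrict (Ioo 0 T)), ballEnergy v t ≤ 2 * (a : ℝ≥0∞) ∧
      DT t ≤ 2 * (a : ℝ≥0∞) := by
    have h := ae_restrict_of_ae_restrict_of_subset (Ioo_subset_Ioo_right hT1) hEn
    filter_upwards [h, ae_restrict_mem measurableSet_Ioo] with t ht htI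
    have hF2 : F t ≤ 2 * (a : ℝ≥0∞) := hboot t ⟨htI.1, htI.2.le⟩
    rw [hFt t ⟨htI.1.le, htI.2.le.trans hT1⟩] at hF2
    exact ⟨(le_self_add.trans ht).trans hF2, (le_add_self.trans ht).trans hF2⟩
  -- the dissipation up to `T`
  have hDall : ∀ t : ℝ, 0 < t → t < T → DT t ≤ 2 * (a : ℝ≥0∞) := by
    intro t ht0 htT
    have hne : (ae (volume.restrict (Ioo t T))).NeBot := by
      rw [ae_neBot, Ne, Measure.restrict_eq_zero, Real.volume_Ioo]
      exact (ENNReal.ofReal_pos.2 (by linarith)).ne'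
    obtain ⟨t', ht', ht'I⟩ := ((ae_restrict_of_ae_restrict_of_subset (Ioo_subset_Ioo_left ht0.le)
      hgood).and (ae_restrict_mem measurableSet_Ioo)).exists
    exact (lintegral_mono_set (Set.prod_mono (Ioo_subset_Ioo_right ht'I.1.le) subset_rfl)).trans ht'.2
  have hDT : DT T ≤ 2 * (a : ℝ≥0∞) := by
    have hU : Ioo (0 : ℝ) T ×ˢ ball (0 : EuclideanSpace ℝ (Fin 3)) 1 =
        ⋃ q : {q : ℚ // 0 < (q : ℝ) ∧ (q : ℝ) < T}, Ioo (0 : ℝ) q ×ˢ ball (0 : EuclideanSpace ℝ (Fin 3)) 1 := by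
      ext z
      simp only [mem_iUnion, mem_prod, mem_Ioo]
      constructor
      · rintro ⟨⟨h0, hT⟩, hB⟩
        obtain ⟨q, hq1, hq2⟩ := exists_rat_btwn hT
        exact ⟨⟨q, h0.trans hq1, hq2⟩, ⟨h0, hq1⟩, hB⟩
      · rintro ⟨q, ⟨h0, hq⟩, hB⟩
        exact ⟨⟨h0, hq.trans q.2.2⟩, hB⟩
    have hdir : Directed (· ⊆ ·) fun q : {q : ℚ // 0 < (q : ℝ) ∧ (q : ℝ) < T} =>
        Ioo (0 : ℝ) q ×ˢ ball (0 : EuclideanSpace ℝ (Fin 3)) 1 := by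
      intro q₁ q₂
      have hmax : (((max q₁.1 q₂.1 : ℚ)) : ℝ) = max (q₁.1 : ℝ) (q₂.1 : ℝ) := Rat.cast_max _ _
      refine ⟨⟨max q₁.1 q₂.1, ?_, ?_⟩, ?_, ?_⟩
      · rw [hmax]; exact lt_max_of_lt_left q₁.2.1
      · rw [hmax]; exact max_lt q₁.2.2 q₂.2.2
      · refine Set.prod_mono (Ioo_subset_Ioo_right ?_) subset_rfl
        show (q₁.1 : ℝ) ≤ ((max q₁.1 q₂.1 : ℚ) : ℝ)
        rw [hmax]; exact le_max_left _ _
      · refine Set.prod_mono (Ioo_subset_Ioo_right ?_) subset_rfl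
        show (q₂.1 : ℝ) ≤ ((max q₁.1 q₂.1 : ℚ) : ℝ)
        rw [hmax]; exact le_max_right _ _
    rw [hDT]
    dsimp only
    rw [hU, setLIntegral_iUnion_of_directed _ hdir]
    exact iSup_le fun q => hDall q q.2.1 q.2.2
  refine ⟨π', hv', ?_, ⟨G, hG, hDT.trans hB1⟩, ?_⟩
  · filter_upwards [hgood] with t ht
    exact ht.1.trans hB1
  · -- the pressure on `(0,T) × B₁`
    have hP := hPr T hT0 hT1
    have hΦ : ∫⁻ σ in Ioo 0 T, (A σ + A σ ^ 3) ≤ I := by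
      calc ∫⁻ σ in Ioo 0 T, (A σ + A σ ^ 3)
          ≤ ∫⁻ _ in Ioo 0 T, (2 * (a : ℝ≥0∞) + (2 * (a : ℝ≥0∞)) ^ 3) := by
            refine setLIntegral_mono' measurableSet_Ioo fun σ hσ => ?_
            have h1 : A σ ≤ 2 * (a : ℝ≥0∞) :=
              (hAF σ hσ.1.le (hσ.2.trans_le hT1)).trans (hboot σ ⟨hσ.1, hσ.2.le⟩)
            exact add_le_add h1 (pow_le_pow_left' h1 3)
        _ = I := by rw [setLIntegral_const, Real.volume_Ioo, sub_zero, hTE]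
    calc ∫⁻ z in Ioo 0 T ×ˢ ball (0 : EuclideanSpace ℝ (Fin 3)) 1, ‖π' z.1 z.2‖ₑ ^ (3 / 2 : ℝ)
        ≤ Cp * ((∫⁻ σ in Ioo 0 T, (A σ + A σ ^ 3)) + DT T) := hP
      _ ≤ Cp * (I + 2 * (a : ℝ≥0∞)) := mul_le_mul' le_rfl (add_le_add hΦ hDT)
      _ ≤ B := hB2

end BradshawTsai2019

end Literature.Analysis.FluidPDE

end
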